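import Literature.NumberTheory.EllipticCurves.Gross2004.RationalCharacterLSeries
import Literature.NumberTheory.EllipticCurves.ArtinFormalismQuadraticLocalProofs
import Literature.NumberTheory.EllipticCurves.BSDConductorProofs
import Literature.NumberTheory.GaloisRepresentations.ArtinReciprocityCharacter
import Literature.NumberTheory.GaloisRepresentations.IntegralGaloisActionProofs
import Literature.NumberTheory.GaloisRepresentations.InertiaTwoQuadraticFields
import Literature.NumberTheory.GaloisRepresentations.InertiaFixesSquareRootsProofs
import Literature.NumberTheory.GaloisRepresentations.KummerQuadraticCharacterInertia
import Literature.NumberTheory.GaloisRepresentations.QuadraticInertia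
import Literature.NumberTheory.GaloisRepresentations.ArtinLFunctionDirichletProofs
import Literature.NumberTheory.QuadraticFields.FundamentalDiscriminant
import Mathlib.NumberTheory.LegendreSymbol.Basic
import Mathlib.NumberTheory.Padics.PadicVal.Basic
import Mathlib.NumberTheory.Multiplicity
import HarnessLib

/-!
# The values "extended by zero" of a rational (genus) character of `Γ_K` in GALOIS currency:
# `heckeValueAt χ_gal v = (d/ℓ)^{f_v}` where `K(√d)/K` is unramified, `= 0` above the primes of `c`

`Proofs` file (theorems only; no definition, no named fact) in topic `NumberTheory/EllipticCurves`,
namespace `Literature.NumberTheory.EllipticCurves.Gross2004`. First file of the discharge of the named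
fact `Gross2004.rankinLSeries_eq_mul_quadraticTwist` (`RationalCharacterLSeries.lean`: Gross, MSRI
Publ. 49 (2004), §2 p. 40, "`L(f, χ, s) = L(A₁, s) L(A₂, s)`" for a rational ring class character
`χ ↔ D = d₁ d₂`), whose left-hand side `rankinSelbergEulerProduct f χ_gal s`
(`RankinSelbergLFunctionK.lean`, Nekovář 1995 (0.5)) is built from
`heckeValueAt χ_gal v := −[T¹] L_v(χ_gal, T)` — minus the linear coefficient of the rank-one Artin
Euler factor. For a character `χ_gal : Γ_K → ℂˣ` which is RATIONAL FOR `d` in Gross's sense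
(`Gross2004.IsRationalCharacterFor χ_gal d`: `χ_gal(γ) = +1` iff `γ` fixes a square root `r` of the
integer `d` in `K̄`) we compute these values at every finite place `v` of `K` at which `K(√d)/K`
is unramified, for an ARBITRARY number field `K` (§1–§3), and prove that they VANISH above the
primes dividing `c` when `K` is quadratic and `d = d₁`, `d₁ d₂ = d_K c²` with `d₁, d₂` fundamental
discriminants — Gross's genus characters of the order of conductor `c` (§4–§6):

* §1 `heckeValueAt_eq_of_isUnramifiedAt'` / `heckeValueAt_eq_zero_of_not_isUnramifiedAt'`:
  `heckeValueAt χ v = χ(Frob_v)` at an unramified place (any arithmetic Frobenius at any `𝔓 ∣ v`),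
  `= 0` at a ramified one; `isUnramifiedAt_ofCharacter_iff'`: unramified iff `χ` kills every
  inertia group above `v` (Neukirch VII §10, proof of (10.6); the tree's rank-one Euler factor
  theorems `FramedArtinRep.eval_eulerFactorAt_of_isUnramifiedAt` /
  `…eulerFactorAt_eq_one_of_not_isUnramifiedAt`). (The same three lemmas exist summit-side in
  `Summits/…/SchneiderFreeAdditiveX3GaloisHeckeValues.lean`, which `Literature/` cannot import; they
  are re-proved here under primed names.)
* §2 **Frobenius on `√d` (Euler's criterion in `\bar ℤ_K / 𝔓`).** For `𝔓 ∣ v ∣ ℓ` with `ℓ` odd,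
  `ℓ ∤ d`, `N v = ℓ^f` and an arithmetic Frobenius `σ` at `𝔓`:
  `σ r = (d/ℓ)^f · r` (`smul_sqrt_eq_legendreSym_pow_mul_of_isArithFrobAt`) — `σ r ≡ r^{N v}`,
  `r^ℓ = r · d^{(ℓ−1)/2} ≡ (d/ℓ) r`, and `σ r = ± r` with `2r ∉ 𝔓`. For `v ∣ 2`, `d ≡ 1 (mod 4)`,
  `N v = 2^f`: `σ r = ε^f r` with `ε = +1` if `d ≡ 1 (mod 8)` and `−1` if `d ≡ 5 (mod 8)`
  (`smul_sqrt_eq_kroneckerTwo_pow_mul_of_isArithFrobAt`) — through the algebraic integer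
  `t = (1 + r)/2`, `t² = t + (d−1)/4`, `t^{2^f} ≡ t + f (d−1)/4 (mod 2)`.
* §3 **Unramified values.** `K(√d)/K` is unramified above `ℓ ∤ 2d`
  (`smul_eq_of_mem_inertia_of_sq_eq_of_notMem`) and above `2` when `d ≡ 1 (mod 4)`
  (`smul_eq_self_of_mem_inertia_of_sq_eq`), whence
  `heckeValueAt χ_gal v = ((d/ℓ) : ℂ)^f` (`heckeValueAt_eq_legendreSym_pow_of_isRationalCharacterFor`)
  resp. `= ε^f` (`heckeValueAt_eq_kroneckerTwo_pow_of_isRationalCharacterFor`). These are the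
  values `(d/ℓ)^{f_v}` of "`χ = χ_d ∘ N_{K/ℚ}`" (Gross 2004 §3, `χ(𝔞) = (d₁ / N𝔞)`), i.e. the
  Kronecker symbol of the fundamental discriminant `d` at the prime `N v`, written with Mathlib's
  `legendreSym` at odd `ℓ` and with the `mod 8` rule at `2` exactly as in the tree's decomposition
  law `Quadratic.primesOver_trichotomy_of_kronecker`.

* §4 **Ramified places, odd `ℓ ∣ c`.** `heckeValueAt_eq_zero_of_inertia_rat`: if above the
  rational place below `w` some inertia element `σ₀ ∈ Γ_ℚ` FIXES `√d_K` and NEGATES `√d`, then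
  `σ₀` is the restriction of an inertia element of `Γ_K` at `w` moving `√d`
  (`mem_range_absGaloisRestrict_of_smul_geomSqrt`, `comap_inertia_comap_absIntegersMap`), so
  `heckeValueAt χ_gal w = 0`. For odd `ℓ ∣ c` one has `ℓ ∥ d₁`, `ℓ ∤ d_K`
  (`not_sq_dvd_of_isFundamental`), and the inertia element negating `√ℓ`
  (`exists_mem_inertia_smul_eq_neg_of_sq_eq_prime`) fixes `√d_K`, `√(d₁/ℓ)`:
  `heckeValueAt_eq_zero_of_isRationalCharacterFor_of_odd_dvd`.
* §5 **The prime `2 ∣ c`: `√−1, √2, √−2 ∈ ℚ(ζ₈)`** with the action of `Γ_ℚ` through the mod-`8`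
  cyclotomic character (`exists_sqrt_negOne_two_negTwo`: `ζ², ζ + ζ⁷, ζ + ζ³`), inertia elements
  at `2` with prescribed `χ₈`-value (`exists_mem_inertia_modEight_val_eq`, from the tree's
  `exists_mem_inertia_modNCyclotomicCharacter_eq`), inertia at `2` fixes `√n` for `n ≡ 1 (mod 4)`
  (`smul_eq_of_emod_four_eq_one`), and the `2`-adic bookkeeping of `d₁ d₂ = d_K c²`
  (`dyadic_configuration`: `4 ∣ d₁`, and the `2`-primary parts `u₁ ≠ u_K ∈ {1, −4, 8, −8}` are
  separated by some odd residue `a (mod 8)`).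
* §6 `heckeValueAt_eq_zero_of_isRationalCharacterFor_of_two_dvd` (the dyadic vanishing) and
  `isRationalCharacterFor_of_mul_eq_discr` (a character rational for `d₁` is rational for `d₂`:
  `√d₂ = θ c √d₁ / d₁` with `θ² = d_K` in `K`), Gross's "`χ` corresponds to the factorization
  `D = d₁ d₂`".

The companion files compute the local factors of the quadratic twists `E^{(d_i)}` and assemble the
Euler product.

## References

* [Gross2004] B. H. Gross, *Heegner points and representation theory*, MSRI Publ. 49 (2004),
  §2 p. 40, §3 p. 40 (`χ(𝔞) = (d₁/N𝔞)` for a genus character).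
* [NeukirchANT1999] J. Neukirch, *Algebraic Number Theory* (1999), Ch. I §8 (quadratic fields,
  Euler's criterion form of the decomposition law), Ch. I §9 (9.4)–(9.6) (Frobenius, inertia),
  Ch. VII §10 proof of (10.6) (`L_𝔭(χ, T) = 1 − χ(φ_𝔓)T`).
* [Nekovar1995] J. Nekovář, Math. Ann. 302 (1995), (0.5), §3.4 ("extended by zero").
* [IrelandRosen1990] K. Ireland, M. Rosen, *A Classical Introduction to Modern Number Theory*
  (2nd ed. 1990), Prop. 5.1.2 (Euler's criterion), Ch. 6 §2 (the quadratic character of `2`: `(ζ + ζ⁻¹)² = 2`),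
  Prop. 13.1.3 (decomposition of primes in quadratic fields).
* [Cox2013] D. A. Cox, *Primes of the form x² + ny²* (2nd ed. 2013), §5.B (5.12) (field
  discriminants), Lemma 1.14 (`χ_D`), Thm. 3.15 (genus theory), Prop. 5.16 (decomposition law).
-/

noncomputable section

open scoped NumberField
open Field IsDedekindDomain NumberField Polynomial
open Literature.NumberTheory.GaloisRepresentations

namespace Literature.NumberTheory.EllipticCurves.Gross2004

universe u

variable {K : Type u} [Field K] [NumberField K]

/-! ## §1 `heckeValueAt` through the rank-one Euler factor -/

omit [NumberField K] in
/-- Entries of a `1 × 1` invertible matrix: `det (ofCharacter χ σ) = χ σ`. [folklore] -/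
private theorem det_ofCharacter_apply' (χ : absoluteGaloisGroup K →ₜ* ℂˣ) (σ : absoluteGaloisGroup K) :
    (FramedRep.det (FramedRep.ofCharacter χ) σ : ℂ) = (χ σ : ℂ) := by
  rw [FramedRep.det_apply, Matrix.GeneralLinearGroup.val_det_apply, Matrix.det_fin_one,
    FramedRep.ofCharacter_apply_coe]

omit [NumberField K] in
/-- `ofCharacter χ` is unramified at `v` iff `χ` kills every inertia group above `v`. [folklore] -/
private theorem isUnramifiedAt_ofCharacter_iff' (χ : absoluteGaloisGroup K →ₜ* ℂˣ)
    (v : HeightOneSpectrum (𝓞 K)) :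
    GaloisRep.IsUnramifiedAt v (FramedArtinRep.toArtinRep (FramedRep.ofCharacter χ)) ↔
      ∀ 𝔓 ∈ v.primesAbove, ∀ σ ∈ 𝔓.inertia (absoluteGaloisGroup K), χ σ = 1 := by
  rw [show GaloisRep.IsUnramifiedAt v (FramedArtinRep.toArtinRep (FramedRep.ofCharacter χ)) ↔
      FramedGaloisRep.IsUnramifiedAt v (FramedRep.ofCharacter χ) from
    FramedGaloisRep.isUnramifiedAt_toGaloisRep_iff v _]
  refine forall₂_congr fun 𝔓 _ => forall₂_congr fun σ _ => ?_
  constructor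
  · intro h
    have := congrArg (fun M : GL (Fin 1) ℂ => (M : Matrix (Fin 1) (Fin 1) ℂ) 0 0) h
    simp only [FramedRep.ofCharacter_apply_coe, Units.val_one, Matrix.one_apply_eq] at this
    exact Units.ext this
  · intro h
    change FramedRep.unitsContinuousMulEquivOfUnique (Fin 1) ℂ (χ σ) = 1
    rw [h, map_one]

/-- **`heckeValueAt` at an unramified place is the value at Frobenius**: if `χ` (as the rank-one
Artin representation `ofCharacter χ`) is unramified at `v`, then for every prime `𝔓 ∣ v` of
`\bar ℤ_K` and every arithmetic Frobenius `σ` at `𝔓`, `heckeValueAt χ v = χ(σ)` (Nekovář 1995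
(0.5): "`𝒲(λ)`, arithmetic Frobenius"; Neukirch VII §10, proof of (10.6):
`L_𝔭(χ, T) = 1 − χ(φ_𝔓) T`). [cite: NeukirchANT1999, Ch. VII §10 Thm. (10.6) (proof)] -/
theorem heckeValueAt_eq_of_isUnramifiedAt' (χ : absoluteGaloisGroup K →ₜ* ℂˣ)
    {v : HeightOneSpectrum (𝓞 K)}
    (hur : GaloisRep.IsUnramifiedAt v (FramedArtinRep.toArtinRep (FramedRep.ofCharacter χ)))
    {𝔓 : Ideal (absIntegers (𝓞 K) K)} (h𝔓 : 𝔓 ∈ v.primesAbove) {σ : absoluteGaloisGroup K}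
    (hσ : IsArithFrobAt (𝓞 K) σ 𝔓) :
    heckeValueAt χ v = (χ σ : ℂ) := by
  set P := ArtinRep.eulerFactorAt (FramedArtinRep.toArtinRep (FramedRep.ofCharacter χ)) v with hP
  have hev : ∀ t : ℂ, P.eval t = 1 - (χ σ : ℂ) * t := fun t ↦ by
    rw [hP, FramedArtinRep.eval_eulerFactorAt_of_isUnramifiedAt _ hur h𝔓 hσ t,
      det_ofCharacter_apply']
  have hPeq : P = C 1 - C (χ σ : ℂ) * X := by
    refine Polynomial.funext fun t ↦ ?_
    rw [hev t, eval_sub, eval_C, eval_mul, eval_C, eval_X]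
  rw [heckeValueAt, ← hP, hPeq]
  simp [Polynomial.coeff_one]

/-- **`heckeValueAt` at a ramified place is `0`** ("extended by zero to ideals that are not prime
to `𝔣`": the Euler factor is `1`). [cite: Nekovar1995, §3.4]
[cite: NeukirchANT1999, Ch. VII §10 Thm. (10.6) (proof)] -/
theorem heckeValueAt_eq_zero_of_not_isUnramifiedAt' (χ : absoluteGaloisGroup K →ₜ* ℂˣ)
    {v : HeightOneSpectrum (𝓞 K)}
    (h : ¬ GaloisRep.IsUnramifiedAt v (FramedArtinRep.toArtinRep (FramedRep.ofCharacter χ))) :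
    heckeValueAt χ v = 0 := by
  rw [heckeValueAt, FramedArtinRep.eulerFactorAt_eq_one_of_not_isUnramifiedAt _ h]
  simp [Polynomial.coeff_one]

/-- At a place where `χ` does not kill some inertia element, `heckeValueAt χ v = 0`
(extension by zero). [cite: Nekovar1995, §3.4] -/
theorem heckeValueAt_eq_zero_of_exists_mem_inertia (χ : absoluteGaloisGroup K →ₜ* ℂˣ)
    {v : HeightOneSpectrum (𝓞 K)} {𝔓 : Ideal (absIntegers (𝓞 K) K)} (h𝔓 : 𝔓 ∈ v.primesAbove)
    {σ : absoluteGaloisGroup K} (hσ : σ ∈ 𝔓.inertia (absoluteGaloisGroup K)) (hχ : χ σ ≠ 1) :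
    heckeValueAt χ v = 0 := by
  refine heckeValueAt_eq_zero_of_not_isUnramifiedAt' χ fun h ↦ hχ ?_
  exact (isUnramifiedAt_ofCharacter_iff' χ v).mp h 𝔓 h𝔓 σ hσ

/-! ## §2 Frobenius on a square root: Euler's criterion in `\bar ℤ_K / 𝔓` -/

section Frobenius

omit [NumberField K] in
/-- A square root of an integer in `K̄` is an algebraic integer. [folklore] -/
private theorem sqrt_mem_absIntegers {r : AlgebraicClosure K} {d : ℤ}
    (hr : r ^ 2 = (d : AlgebraicClosure K)) : r ∈ absIntegers (𝓞 K) K := by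
  have hrZ : IsIntegral ℤ r := by
    refine ⟨X ^ 2 - C d, monic_X_pow_sub_C _ two_ne_zero, ?_⟩
    rw [eval₂_sub, eval₂_X_pow, eval₂_C, eq_intCast, hr, sub_self]
  rw [mem_integralClosure_iff]; exact hrZ.tower_top

omit [NumberField K] in
/-- `γ ∈ Γ_K` fixes the integers of `K̄`. [folklore] -/
private theorem smul_intCast_algebraicClosure (γ : absoluteGaloisGroup K) (d : ℤ) :
    γ • (d : AlgebraicClosure K) = d := by
  rw [absoluteGaloisGroup.smul_def, map_intCast]

omit [NumberField K] in
/-- Every `γ ∈ Γ_K` sends a square root `r` of an integer `d` to `± r`. [folklore] -/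
private theorem smul_sqrt_eq_or_eq_neg (γ : absoluteGaloisGroup K) {r : AlgebraicClosure K} {d : ℤ}
    (hr : r ^ 2 = (d : AlgebraicClosure K)) : γ • r = r ∨ γ • r = -r := by
  have h2 : (γ • r) ^ 2 = r ^ 2 := by
    rw [absoluteGaloisGroup.smul_def, ← map_pow, hr, map_intCast]
  exact sq_eq_sq_iff_eq_or_eq_neg.mp h2

/-- A square root of a non-zero integer is not fixed by negation (characteristic `0`). [folklore] -/
private theorem sqrt_ne_neg_self {r : AlgebraicClosure K} {d : ℤ} (hd : d ≠ 0)
    (hr : r ^ 2 = (d : AlgebraicClosure K)) : -r ≠ r := by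
  haveI : CharZero (AlgebraicClosure K) :=
    charZero_of_injective_algebraMap (algebraMap K (AlgebraicClosure K)).injective
  intro h
  have h2 : (2 : AlgebraicClosure K) * r = 0 := by linear_combination -h
  rcases mul_eq_zero.mp h2 with h0 | h0
  · exact two_ne_zero h0
  · rw [h0, zero_pow two_ne_zero] at hr
    exact hd (by exact_mod_cast hr.symm)

omit [NumberField K] in
/-- If a prime `𝔓 ∣ v` of `\bar ℤ_K` lies over the finite place `v ∋ n`, then `n ∈ 𝔓`. [folklore] -/
private theorem intCast_mem_of_mem_primesAbove {v : HeightOneSpectrum (𝓞 K)} {n : ℤ}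
    (hv : (n : 𝓞 K) ∈ v.asIdeal) {𝔓 : Ideal (absIntegers (𝓞 K) K)} (h𝔓 : 𝔓 ∈ v.primesAbove) :
    (n : absIntegers (𝓞 K) K) ∈ 𝔓 := by
  have h1 : (n : 𝓞 K) ∈ 𝔓.under (𝓞 K) := by rwa [← h𝔓.2.over]
  rw [Ideal.under_def, Ideal.mem_comap, map_intCast] at h1
  exact h1

/-- An integer prime to a rational prime `ℓ ∈ v` does not lie in `v`. [folklore] -/
private theorem intCast_not_mem_asIdeal_of_not_dvd {v : HeightOneSpectrum (𝓞 K)} {ℓ : ℕ} (hℓ : ℓ.Prime)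
    (hℓv : (ℓ : 𝓞 K) ∈ v.asIdeal) {m : ℤ} (hm : ¬ (ℓ : ℤ) ∣ m) : (m : 𝓞 K) ∉ v.asIdeal := by
  intro hmv
  have hcop : IsCoprime m (ℓ : ℤ) :=
    (((Nat.prime_iff_prime_int.mp hℓ).coprime_iff_not_dvd).mpr hm).symm
  obtain ⟨a, b, hab⟩ := hcop
  apply v.isPrime.ne_top
  rw [Ideal.eq_top_iff_one]
  have h1 : ((a : 𝓞 K)) * m + b * ℓ = 1 := by exact_mod_cast hab
  rw [← h1]
  exact v.asIdeal.add_mem (v.asIdeal.mul_mem_left _ hmv) (v.asIdeal.mul_mem_left _ hℓv)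

/-- An integer prime to a rational prime `ℓ ∈ 𝔓` does not lie in the prime `𝔓` of `\bar ℤ_K`.
[folklore] -/
private theorem intCast_not_mem_of_not_dvd {𝔓 : Ideal (absIntegers (𝓞 K) K)} [𝔓.IsPrime] {ℓ : ℕ}
    (hℓ : ℓ.Prime) (hℓ𝔓 : ((ℓ : ℤ) : absIntegers (𝓞 K) K) ∈ 𝔓) {m : ℤ} (hm : ¬ (ℓ : ℤ) ∣ m) :
    (m : absIntegers (𝓞 K) K) ∉ 𝔓 := by
  have hcop : IsCoprime m (ℓ : ℤ) :=
    (((Nat.prime_iff_prime_int.mp hℓ).coprime_iff_not_dvd).mpr hm).symm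
  obtain ⟨a, b, hab⟩ := hcop
  exact intCast_not_mem_of_intCast_mem hab hℓ𝔓

/-- In a ring in which the odd prime `ℓ` vanishes, Euler's criterion holds:
`d^{(ℓ−1)/2} = (d/ℓ)`. [cite: IrelandRosen1990, Prop. 5.1.2 (Euler's criterion)] -/
theorem intCast_pow_div_two_eq_legendreSym {A : Type*} [CommRing A] [Nontrivial A] {ℓ : ℕ}
    [Fact ℓ.Prime] (hℓA : (ℓ : A) = 0) (d : ℤ) :
    (d : A) ^ (ℓ / 2) = ((legendreSym ℓ d : ℤ) : A) := by
  haveI : CharP A ℓ := (CharP.charP_iff_prime_eq_zero Fact.out).mpr hℓA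
  have h := congrArg (ZMod.castHom (dvd_refl ℓ) A) (legendreSym.eq_pow ℓ d)
  rw [map_intCast, map_pow, map_intCast] at h
  exact h.symm

/-- **Frobenius on `√d` at an odd place prime to `d` (Euler's criterion).** Let `v` be a finite
place of `K` above the odd prime `ℓ ∤ d`, `N v = ℓ^f`, `𝔓 ∣ v` a prime of `\bar ℤ_K`, `σ ∈ Γ_K`
an arithmetic Frobenius at `𝔓`, and `r ∈ K̄` with `r² = d`. Then `σ r = (d/ℓ)^f · r`:
`σ r ≡ r^{ℓ^f} (mod 𝔓)`, `r^ℓ = r (r²)^{(ℓ−1)/2} ≡ (d/ℓ) r`, and `σ r = ± r` with `2 r ∉ 𝔓`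
(`(2r)² = 4d` is prime to `ℓ`). This is the Frobenius form of the decomposition law of
`K(√d)/K` above `ℓ` (Ireland–Rosen 13.1.3; Neukirch I §8).
[cite: IrelandRosen1990, Prop. 5.1.2 and Prop. 13.1.3] -/
theorem smul_sqrt_eq_legendreSym_pow_mul_of_isArithFrobAt {v : HeightOneSpectrum (𝓞 K)}
    {ℓ : ℕ} [Fact ℓ.Prime] (hℓ2 : ℓ ≠ 2) (hℓv : (ℓ : 𝓞 K) ∈ v.asIdeal) {f : ℕ}
    (hq : v.residueCard = ℓ ^ f) {d : ℤ} (hd : ¬ (ℓ : ℤ) ∣ d) {r : AlgebraicClosure K}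
    (hr : r ^ 2 = (d : AlgebraicClosure K)) {𝔓 : Ideal (absIntegers (𝓞 K) K)}
    (h𝔓 : 𝔓 ∈ v.primesAbove) {σ : absoluteGaloisGroup K} (hσ : IsArithFrobAt (𝓞 K) σ 𝔓) :
    σ • r = (((legendreSym ℓ d) ^ f : ℤ) : AlgebraicClosure K) * r := by
  have hℓ : ℓ.Prime := Fact.out
  haveI : 𝔓.IsPrime := h𝔓.1
  set z : absIntegers (𝓞 K) K := ⟨r, sqrt_mem_absIntegers hr⟩ with hzdef
  set η : ℤ := (legendreSym ℓ d) ^ f with hηdef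
  -- `ℓ ∈ 𝔓`, `4d ∉ 𝔓`
  have hℓ𝔓 : ((ℓ : ℤ) : absIntegers (𝓞 K) K) ∈ 𝔓 :=
    intCast_mem_of_mem_primesAbove (by exact_mod_cast hℓv) h𝔓
  have h4d : ((4 * d : ℤ) : absIntegers (𝓞 K) K) ∉ 𝔓 := by
    refine intCast_not_mem_of_not_dvd hℓ hℓ𝔓 fun h ↦ ?_
    have hℓp : Prime (ℓ : ℤ) := Nat.prime_iff_prime_int.mp hℓ
    rcases hℓp.dvd_or_dvd h with h4 | h4
    · have : (ℓ : ℤ) ∣ 2 ^ 2 := by simpa using h4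
      have h2 := hℓp.dvd_of_dvd_pow this
      have : ℓ ∣ 2 := by exact_mod_cast h2
      exact hℓ2 ((Nat.prime_dvd_prime_iff_eq hℓ Nat.prime_two).mp this)
    · exact hd h4
  -- in `A = \bar ℤ_K / 𝔓`: `σ z ≡ z ^ (ℓ ^ f)`
  set A := absIntegers (𝓞 K) K ⧸ 𝔓 with hA
  haveI : Nontrivial A := Ideal.Quotient.nontrivial_iff.mpr (Ideal.IsPrime.ne_top ‹_›)
  set π : absIntegers (𝓞 K) K →+* A := Ideal.Quotient.mk 𝔓 with hπ
  have hfrob : π (σ • z) = π z ^ (ℓ ^ f) := by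
    have h := (HeightOneSpectrum.isArithFrobAt_iff_of_mem_primesAbove h𝔓 σ).mp hσ z
    rw [hq] at h
    rw [← map_pow, hπ, Ideal.Quotient.eq]
    exact h
  have hℓA : (ℓ : A) = 0 := by
    have := (Ideal.Quotient.eq_zero_iff_mem.mpr hℓ𝔓 : π ((ℓ : ℤ) : absIntegers (𝓞 K) K) = 0)
    rwa [map_intCast, Int.cast_natCast] at this
  -- `(π z)² = d`, `(π z)^ℓ = ε π z` with `ε = (d/ℓ)`, `ε^ℓ = ε`
  set ε : A := ((legendreSym ℓ d : ℤ) : A) with hεdef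
  have hz2 : π z ^ 2 = (d : A) := by
    have h1 : z ^ 2 = ((d : ℤ) : absIntegers (𝓞 K) K) := Subtype.ext (by
      rw [hzdef]; push_cast; exact hr)
    rw [← map_pow, h1, map_intCast]
  have hεsq : ε = 1 ∨ ε = -1 := by
    have hd0 : ((d : ℤ) : ZMod ℓ) ≠ 0 := by
      rwa [Ne, ZMod.intCast_zmod_eq_zero_iff_dvd]
    rcases legendreSym.eq_one_or_neg_one ℓ hd0 with h | h
    · left; rw [hεdef, h]; push_cast; rfl
    · right; rw [hεdef, h]; push_cast; rfl
  obtain ⟨k, hk⟩ : Odd ℓ := hℓ.odd_of_ne_two hℓ2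
  have hε2 : ε ^ 2 = 1 := by rcases hεsq with h | h <;> rw [h] <;> norm_num
  have hεℓ : ε ^ ℓ = ε := by rw [hk, pow_succ, pow_mul, hε2, one_pow, one_mul]
  have hzℓ : π z ^ ℓ = ε * π z := by
    have hk2 : ℓ / 2 = k := by omega
    rw [hk, pow_succ, pow_mul, hz2, ← hk2, intCast_pow_div_two_eq_legendreSym hℓA d]
  have hpow : ∀ n : ℕ, π z ^ (ℓ ^ n) = ε ^ n * π z := by
    intro n
    induction n with
    | zero => simp
    | succ n ih =>
      rw [pow_succ, pow_mul, ih, mul_pow, ← pow_mul, mul_comm n ℓ, pow_mul, hεℓ, hzℓ, pow_succ]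
      ring
  -- hence `σ z - η z ∈ 𝔓`
  have hkey : σ • z - (η : absIntegers (𝓞 K) K) * z ∈ 𝔓 := by
    rw [← Ideal.Quotient.eq, ← hπ, hfrob, hpow f, map_mul, map_intCast, hηdef]
    push_cast
    rw [hεdef]
  -- `2 z ∉ 𝔓`
  have hzr : ((z : absIntegers (𝓞 K) K) : AlgebraicClosure K) = r := rfl
  have h2z : z + z ∉ 𝔓 := by
    intro h
    apply h4d
    have h' : (z + z) * (z + z) ∈ 𝔓 := 𝔓.mul_mem_left _ h
    have heq : (z + z) * (z + z) = ((4 * d : ℤ) : absIntegers (𝓞 K) K) := Subtype.ext (by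
      rw [SubringClass.coe_intCast]
      push_cast
      rw [hzr]
      linear_combination (4 : AlgebraicClosure K) * hr)
    rwa [heq] at h'
  -- `η = ± 1` and `σ r = ± r`; the mismatched signs put `2 z` in `𝔓`
  have hη : η = 1 ∨ η = -1 := by
    have hd0 : ((d : ℤ) : ZMod ℓ) ≠ 0 := by
      rwa [Ne, ZMod.intCast_zmod_eq_zero_iff_dvd]
    rcases legendreSym.eq_one_or_neg_one ℓ hd0 with h | h
    · left; rw [hηdef, h, one_pow]
    · rw [hηdef, h]
      rcases Nat.even_or_odd f with hf | hf
      · left; exact hf.neg_one_pow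
      · right; exact hf.neg_one_pow
  have hcoe : ((σ • z : absIntegers (𝓞 K) K) : AlgebraicClosure K) = σ • r := by
    rw [hzdef, integralClosure.coe_smul]
  have hpm := smul_sqrt_eq_or_eq_neg σ hr
  rcases hpm with h | h <;> rcases hη with h' | h'
  · rw [h, h']; push_cast; ring
  · exfalso
    apply h2z
    have heq : σ • z - (η : absIntegers (𝓞 K) K) * z = z + z := Subtype.ext (by
      push_cast
      rw [hcoe, h, h', hzr]; push_cast; ring)
    rwa [heq] at hkey
  · exfalso
    apply h2z
    have heq : σ • z - (η : absIntegers (𝓞 K) K) * z = -(z + z) := Subtype.ext (by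
      push_cast
      rw [hcoe, h, h', hzr]; push_cast; ring)
    rw [heq, neg_mem_iff] at hkey
    exact hkey
  · rw [h, h']; push_cast; ring

/-- In a ring in which `2 = 0`, the image of an integer is idempotent: `m² = m` (`𝔽₂ ⊆ A`).
[folklore] -/
private theorem intCast_sq_eq_self_of_two_eq_zero {A : Type*} [CommRing A] [Nontrivial A]
    (h2A : (2 : A) = 0) (m : ℤ) : (m : A) ^ 2 = (m : A) := by
  haveI : CharP A 2 := (CharP.charP_iff_prime_eq_zero Nat.prime_two).mpr (by exact_mod_cast h2A)
  have h := congrArg (ZMod.castHom (dvd_refl 2) A) (ZMod.pow_card (m : ZMod 2))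
  rw [map_pow, map_intCast] at h
  exact h

/-- In a ring in which `2 = 0`, the image of an integer `m` is `0` or `1` according to the parity
of `m`. [folklore] -/
private theorem intCast_eq_of_two_eq_zero {A : Type*} [CommRing A] (h2A : (2 : A) = 0) (m : ℤ) :
    (m : A) = if m % 2 = 0 then 0 else 1 := by
  have hm : (m : A) = ((m % 2 : ℤ) : A) := by
    have h : m = 2 * (m / 2) + m % 2 := by omega
    conv_lhs => rw [h]
    rw [Int.cast_add, Int.cast_mul, Int.cast_ofNat, h2A, zero_mul, zero_add]
  rw [hm]
  rcases Int.emod_two_eq_zero_or_one m with h | h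
  · rw [h, if_pos rfl, Int.cast_zero]
  · rw [h, if_neg one_ne_zero, Int.cast_one]

/-- **Frobenius on `√d` above `2` for `d ≡ 1 (mod 4)`.** Let `v ∣ 2` be a finite place of `K` with
`N v = 2^f`, `𝔓 ∣ v`, `σ ∈ Γ_K` an arithmetic Frobenius at `𝔓`, and `r ∈ K̄` with `r² = d`,
`d ≡ 1 (mod 4)`. Then `σ r = ε^f r` with `ε = +1` if `d ≡ 1 (mod 8)`, `ε = −1` if `d ≡ 5 (mod 8)`:
for the algebraic integer `t = (1 + r)/2` one has `t² = t + k`, `d = 4k + 1`, hence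
`σ t ≡ t^{2^f} ≡ t + f k (mod 𝔓)`; `σ r = r` gives `f k ≡ 0`, `σ r = −r` gives `σ t = 1 − t` and
`f k ≡ 1 (mod 𝔓)`. This is the Frobenius form of the decomposition law of `K(√d)/K` above `2`
(`2` splits in `ℚ(√d)` iff `d ≡ 1 (mod 8)`, Ireland–Rosen 13.1.4; Neukirch I §8).
[cite: IrelandRosen1990, Prop. 13.1.4] -/
theorem smul_sqrt_eq_kroneckerTwo_pow_mul_of_isArithFrobAt {v : HeightOneSpectrum (𝓞 K)}
    (h2v : (2 : 𝓞 K) ∈ v.asIdeal) {f : ℕ} (hq : v.residueCard = 2 ^ f) {d : ℤ} (hd4 : d % 4 = 1)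
    {r : AlgebraicClosure K} (hr : r ^ 2 = (d : AlgebraicClosure K))
    {𝔓 : Ideal (absIntegers (𝓞 K) K)} (h𝔓 : 𝔓 ∈ v.primesAbove) {σ : absoluteGaloisGroup K}
    (hσ : IsArithFrobAt (𝓞 K) σ 𝔓) :
    σ • r = (((if d % 8 = 1 then 1 else -1 : ℤ) ^ f : ℤ) : AlgebraicClosure K) * r := by
  haveI : 𝔓.IsPrime := h𝔓.1
  haveI : CharZero (AlgebraicClosure K) :=
    charZero_of_injective_algebraMap (algebraMap K (AlgebraicClosure K)).injective
  -- `d = 4k + 1`, `t = (1 + r)/2`, `t² = t + k`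
  set k : ℤ := d / 4 with hkdef
  have hdk : d = 4 * k + 1 := by rw [hkdef]; omega
  set t : AlgebraicClosure K := (1 + r) / 2 with ht
  have htZ : IsIntegral ℤ t := by
    refine ⟨X ^ 2 - X - C k, ?_, ?_⟩
    · have h : (X ^ 2 - X - C k : ℤ[X]) = X ^ 2 - (X + C k) := by ring
      rw [h]
      exact monic_X_pow_sub (by compute_degree!)
    · have hm' : ((4 * k + 1 : ℤ) : AlgebraicClosure K) = (d : AlgebraicClosure K) := by rw [hdk]
      have key : t ^ 2 - t - (k : AlgebraicClosure K) =
          (r ^ 2 - ((4 * k + 1 : ℤ) : AlgebraicClosure K)) / 4 := by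
        rw [ht]; push_cast; ring
      rw [eval₂_sub, eval₂_sub, eval₂_X_pow, eval₂_X, eval₂_C, eq_intCast, key, hm', hr, sub_self,
        zero_div]
  have htI : t ∈ absIntegers (𝓞 K) K := by
    rw [mem_integralClosure_iff]; exact htZ.tower_top
  set w : absIntegers (𝓞 K) K := ⟨t, htI⟩ with hwdef
  have hwt : ((w : absIntegers (𝓞 K) K) : AlgebraicClosure K) = t := rfl
  have ht2 : t ^ 2 = t + k := by
    have : (4 : AlgebraicClosure K) * (t ^ 2 - t - k) = r ^ 2 - d := by
      rw [ht, hdk]; push_cast; ring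
    rw [hr, sub_self] at this
    have h4 : (4 : AlgebraicClosure K) ≠ 0 := by norm_num
    have := (mul_eq_zero.mp this).resolve_left h4
    linear_combination this
  -- in `A = \bar ℤ_K / 𝔓` (characteristic `2`): `σ w ≡ w + f k`
  set A := absIntegers (𝓞 K) K ⧸ 𝔓 with hA
  haveI : Nontrivial A := Ideal.Quotient.nontrivial_iff.mpr (Ideal.IsPrime.ne_top ‹_›)
  set π : absIntegers (𝓞 K) K →+* A := Ideal.Quotient.mk 𝔓 with hπ
  have h2𝔓 : ((2 : ℤ) : absIntegers (𝓞 K) K) ∈ 𝔓 :=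
    intCast_mem_of_mem_primesAbove (by exact_mod_cast h2v) h𝔓
  have h2A : (2 : A) = 0 := by
    have := (Ideal.Quotient.eq_zero_iff_mem.mpr h2𝔓 : π ((2 : ℤ) : absIntegers (𝓞 K) K) = 0)
    rwa [map_intCast, Int.cast_ofNat] at this
  have hw2 : π w ^ 2 = π w + (k : A) := by
    have h1 : w ^ 2 = w + ((k : ℤ) : absIntegers (𝓞 K) K) := Subtype.ext (by
      push_cast; rw [hwt]; exact ht2)
    rw [← map_pow, h1, map_add, map_intCast]
  have hk2 : (k : A) ^ 2 = (k : A) := intCast_sq_eq_self_of_two_eq_zero h2A k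
  have hpow : ∀ n : ℕ, π w ^ (2 ^ n) = π w + (n : A) * (k : A) := by
    intro n
    induction n with
    | zero => simp
    | succ n ih =>
      have hn2 : (n : A) ^ 2 = (n : A) := by
        have := intCast_sq_eq_self_of_two_eq_zero h2A n
        rwa [Int.cast_natCast] at this
      rw [pow_succ, pow_mul, ih, add_sq, hw2, mul_pow, hn2, hk2, mul_assoc, h2A, zero_mul,
        add_zero, Nat.cast_succ]
      ring
  have hfrob : π (σ • w) = π w + (f : A) * (k : A) := by
    have h := (HeightOneSpectrum.isArithFrobAt_iff_of_mem_primesAbove h𝔓 σ).mp hσ w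
    rw [hq] at h
    rw [← hpow f, ← map_pow, hπ, Ideal.Quotient.eq]
    exact h
  have hσt : σ • t = (1 + σ • r) / 2 := by
    rw [ht, absoluteGaloisGroup.smul_def, map_div₀, map_add, map_one, map_ofNat,
      ← absoluteGaloisGroup.smul_def]
  have hcoe : ((σ • w : absIntegers (𝓞 K) K) : AlgebraicClosure K) = σ • t := by
    rw [hwdef, integralClosure.coe_smul]
  -- the two cases `σ r = ± r` read off `f k (mod 2)`
  have hfix : σ • r = r → (f : A) * (k : A) = 0 := by
    intro h
    have hσw : σ • w = w := Subtype.ext (by rw [hcoe, hσt, h, hwt, ht])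
    rw [hσw] at hfrob
    exact (add_eq_left.mp hfrob.symm)
  have hneg : σ • r = -r → (f : A) * (k : A) = 1 := by
    intro h
    have hσw : σ • w = 1 - w := Subtype.ext (by
      push_cast; rw [hcoe, hσt, h, hwt, ht]; ring)
    rw [hσw, map_sub, map_one] at hfrob
    linear_combination -hfrob - (π w) * h2A
  have hcast : (f : A) * (k : A) = if ((f : ℤ) * k) % 2 = 0 then 0 else 1 := by
    have := intCast_eq_of_two_eq_zero h2A ((f : ℤ) * k)
    rwa [Int.cast_mul, Int.cast_natCast] at this
  have hd8 : d % 8 = 1 ↔ k % 2 = 0 := by omega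
  rcases smul_sqrt_eq_or_eq_neg σ hr with h | h
  · -- `σ r = r`: `f k` even
    have h0 := hfix h
    rw [hcast] at h0
    have hfk : ((f : ℤ) * k) % 2 = 0 := by
      by_contra hne; rw [if_neg hne] at h0; exact one_ne_zero h0
    rw [h]
    by_cases hk : k % 2 = 0
    · rw [if_pos (hd8.mpr hk), one_pow, Int.cast_one, one_mul]
    · have hf : Even f := by
        have hk' : Odd k := Int.odd_iff.mpr (Int.emod_two_ne_zero.mp hk)
        have hfe : Even ((f : ℤ) * k) := Int.even_iff.mpr hfk
        rcases Int.even_mul.mp hfe with hf | hke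
        · exact (Int.even_coe_nat f).mp hf
        · exact absurd hke (Int.not_even_iff_odd.mpr hk')
      rw [if_neg (fun h8 => hk (hd8.mp h8)), hf.neg_one_pow, Int.cast_one, one_mul]
  · -- `σ r = −r`: `f k` odd
    have h1 := hneg h
    rw [hcast] at h1
    have hfk : ((f : ℤ) * k) % 2 ≠ 0 := by
      intro he; rw [if_pos he] at h1; exact zero_ne_one h1
    have hodd : Odd ((f : ℤ) * k) := Int.odd_iff.mpr (Int.emod_two_ne_zero.mp hfk)
    obtain ⟨hf, hk⟩ := Int.odd_mul.mp hodd
    have hf' : Odd f := (Int.odd_coe_nat f).mp hf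
    have hk' : k % 2 ≠ 0 := by rw [Int.odd_iff.mp hk]; exact one_ne_zero
    rw [h, if_neg (fun h8 => hk' (hd8.mp h8)), hf'.neg_one_pow]
    push_cast; ring

end Frobenius

/-! ## §3 The unramified places: `heckeValueAt χ_gal v = (d/ℓ)^{f_v}` -/

section Unramified

omit [NumberField K] in
open scoped Classical in
/-- The value of a rational character at `σ` is `1` iff `σ` fixes the square root (unfolding).
[cite: Gross2004, §2 p. 40 (rational characters; unfolding)] -/
theorem coe_apply_eq_of_smul_eq {χgal : absoluteGaloisGroup K →ₜ* ℂˣ} {r : AlgebraicClosure K}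
    (hχ : ∀ γ : absoluteGaloisGroup K, ((χgal γ : ℂˣ) : ℂ) = if γ • r = r then 1 else -1)
    {σ : absoluteGaloisGroup K} {η : ℤ} (hη : η = 1 ∨ η = -1) (hr0 : -r ≠ r)
    (hσ : σ • r = (η : AlgebraicClosure K) * r) : ((χgal σ : ℂˣ) : ℂ) = (η : ℂ) := by
  rw [hχ σ]
  rcases hη with h | h
  · rw [h, Int.cast_one, one_mul] at hσ
    rw [if_pos hσ, h, Int.cast_one]
  · rw [h, Int.cast_neg, Int.cast_one, neg_one_mul] at hσ
    rw [if_neg (by rw [hσ]; exact hr0), h, Int.cast_neg, Int.cast_one]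

/-- **`K(√d)/K` is unramified above an odd prime `ℓ ∤ d`**: a rational character for `d` kills
every inertia group above every place `v ∣ ℓ` (`√d` is the square root of a `v`-unit,
`smul_eq_of_mem_inertia_of_sq_eq_of_notMem`; Neukirch II (7.13)).
[cite: NeukirchANT1999, Ch. II Prop. (7.13)] -/
theorem isUnramifiedAt_of_isRationalCharacterFor_of_odd {χgal : absoluteGaloisGroup K →ₜ* ℂˣ}
    {d : ℤ} (hχ : IsRationalCharacterFor χgal d) {v : HeightOneSpectrum (𝓞 K)} {ℓ : ℕ}
    (hℓ : ℓ.Prime) (hℓ2 : ℓ ≠ 2) (hℓv : (ℓ : 𝓞 K) ∈ v.asIdeal) (hd : ¬ (ℓ : ℤ) ∣ d) :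
    GaloisRep.IsUnramifiedAt v (FramedArtinRep.toArtinRep (FramedRep.ofCharacter χgal)) := by
  rw [isUnramifiedAt_ofCharacter_iff']
  intro 𝔓 h𝔓 σ hσ
  obtain ⟨r, hr, hχr⟩ := hχ
  have h2 : (2 : 𝓞 K) ∉ v.asIdeal := two_not_mem_of_natCast_prime_mem hℓ hℓ2 hℓv
  have hu : ((d : ℤ) : 𝓞 K) ∉ v.asIdeal := intCast_not_mem_asIdeal_of_not_dvd hℓ hℓv hd
  have hα : r ^ 2 = algebraMap (𝓞 K) (AlgebraicClosure K) ((d : ℤ) : 𝓞 K) := by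
    rw [hr, map_intCast]
  have hfix := smul_eq_of_mem_inertia_of_sq_eq_of_notMem v h𝔓 hσ h2 hu hα
  apply Units.ext
  rw [hχr σ, if_pos hfix, Units.val_one]

/-- **`K(√d)/K` is unramified above `2` for `d ≡ 1 (mod 4)`**: a rational character for `d`
kills every inertia group above every place `v ∣ 2` (`(1 + √d)/2` is an algebraic integer;
`smul_eq_self_of_mem_inertia_of_sq_eq`; Neukirch I §8, Marcus Ch. 2 Thm. 1).
[cite: NeukirchANT1999, Ch. I §8] -/
theorem isUnramifiedAt_of_isRationalCharacterFor_two {χgal : absoluteGaloisGroup K →ₜ* ℂˣ}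
    {d : ℤ} (hχ : IsRationalCharacterFor χgal d) {v : HeightOneSpectrum (𝓞 K)}
    (h2v : (2 : 𝓞 K) ∈ v.asIdeal) (hd4 : d % 4 = 1) :
    GaloisRep.IsUnramifiedAt v (FramedArtinRep.toArtinRep (FramedRep.ofCharacter χgal)) := by
  rw [isUnramifiedAt_ofCharacter_iff']
  intro 𝔓 h𝔓 σ hσ
  haveI : 𝔓.IsPrime := h𝔓.1
  obtain ⟨r, hr, hχr⟩ := hχ
  have hdk : d = 4 * (d / 4) + 1 := by omega
  have h2𝔓 : ((2 : ℤ) : absIntegers (𝓞 K) K) ∈ 𝔓 :=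
    intCast_mem_of_mem_primesAbove (by exact_mod_cast h2v) h𝔓
  have hd𝔓 : ((d : ℤ) : absIntegers (𝓞 K) K) ∉ 𝔓 :=
    intCast_not_mem_of_not_dvd Nat.prime_two (by exact_mod_cast h2𝔓) (by omega)
  have hfix := smul_eq_self_of_mem_inertia_of_sq_eq hdk hr hd𝔓 hσ
  apply Units.ext
  rw [hχr σ, if_pos hfix, Units.val_one]

/-- **`heckeValueAt χ_gal v = (d/ℓ)^f` above an odd prime `ℓ ∤ d`** (`N v = ℓ^f`), for a rational
character `χ_gal` for `d`: the place is unramified and the arithmetic Frobenius acts on `√d` by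
`(d/ℓ)^f` (Euler's criterion). This is the value `χ(𝔞) = (d/N𝔞)` of Gross's genus character
(MSRI Publ. 49, §3) at `𝔞 = v`, "extended by zero" in the sense of Nekovář (0.5).
[cite: Gross2004, §3 p. 40] [cite: IrelandRosen1990, Prop. 13.1.3] -/
theorem heckeValueAt_eq_legendreSym_pow_of_isRationalCharacterFor
    {χgal : absoluteGaloisGroup K →ₜ* ℂˣ} {d : ℤ} (hχ : IsRationalCharacterFor χgal d)
    {v : HeightOneSpectrum (𝓞 K)} {ℓ : ℕ} [Fact ℓ.Prime] (hℓ2 : ℓ ≠ 2)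
    (hℓv : (ℓ : 𝓞 K) ∈ v.asIdeal) {f : ℕ} (hq : v.residueCard = ℓ ^ f) (hd : ¬ (ℓ : ℤ) ∣ d) :
    heckeValueAt χgal v = ((legendreSym ℓ d : ℤ) : ℂ) ^ f := by
  have hℓ : ℓ.Prime := Fact.out
  obtain ⟨𝔓, h𝔓⟩ := v.primesAbove_nonempty
  obtain ⟨σ, hσ⟩ := HeightOneSpectrum.exists_isArithFrobAt_of_mem_primesAbove_holds h𝔓
  rw [heckeValueAt_eq_of_isUnramifiedAt' χgal
    (isUnramifiedAt_of_isRationalCharacterFor_of_odd hχ hℓ hℓ2 hℓv hd) h𝔓 hσ]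
  obtain ⟨r, hr, hχr⟩ := hχ
  have key := smul_sqrt_eq_legendreSym_pow_mul_of_isArithFrobAt hℓ2 hℓv hq hd hr h𝔓 hσ
  have hd0 : d ≠ 0 := fun h0 => hd (by rw [h0]; exact dvd_zero _)
  have hη : (legendreSym ℓ d) ^ f = 1 ∨ (legendreSym ℓ d) ^ f = -1 := by
    have hdℓ : ((d : ℤ) : ZMod ℓ) ≠ 0 := by rwa [Ne, ZMod.intCast_zmod_eq_zero_iff_dvd]
    rcases legendreSym.eq_one_or_neg_one ℓ hdℓ with h | h
    · left; rw [h, one_pow]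
    · rw [h]
      rcases Nat.even_or_odd f with hf | hf
      · left; exact hf.neg_one_pow
      · right; exact hf.neg_one_pow
  rw [coe_apply_eq_of_smul_eq hχr hη (sqrt_ne_neg_self hd0 hr) key]
  push_cast; rfl

/-- **`heckeValueAt χ_gal v = ε^f` above `2` for `d ≡ 1 (mod 4)`** (`N v = 2^f`, `ε = ±1` as
`d ≡ 1, 5 (mod 8)`), for a rational character `χ_gal` for `d`: the value `(d/2)^f` of the Kronecker
symbol of `d` at `N v`. [cite: Gross2004, §3 p. 40] [cite: IrelandRosen1990, Prop. 13.1.4] -/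
theorem heckeValueAt_eq_kroneckerTwo_pow_of_isRationalCharacterFor
    {χgal : absoluteGaloisGroup K →ₜ* ℂˣ} {d : ℤ} (hχ : IsRationalCharacterFor χgal d)
    {v : HeightOneSpectrum (𝓞 K)} (h2v : (2 : 𝓞 K) ∈ v.asIdeal) {f : ℕ}
    (hq : v.residueCard = 2 ^ f) (hd4 : d % 4 = 1) :
    heckeValueAt χgal v = (if d % 8 = 1 then 1 else -1 : ℂ) ^ f := by
  obtain ⟨𝔓, h𝔓⟩ := v.primesAbove_nonempty
  obtain ⟨σ, hσ⟩ := HeightOneSpectrum.exists_isArithFrobAt_of_mem_primesAbove_holds h𝔓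
  rw [heckeValueAt_eq_of_isUnramifiedAt' χgal
    (isUnramifiedAt_of_isRationalCharacterFor_two hχ h2v hd4) h𝔓 hσ]
  obtain ⟨r, hr, hχr⟩ := hχ
  have key := smul_sqrt_eq_kroneckerTwo_pow_mul_of_isArithFrobAt h2v hq hd4 hr h𝔓 hσ
  have hd0 : d ≠ 0 := by omega
  have hη : (if d % 8 = 1 then 1 else -1 : ℤ) ^ f = 1 ∨
      (if d % 8 = 1 then 1 else -1 : ℤ) ^ f = -1 := by
    split_ifs
    · left; exact one_pow _
    · rcases Nat.even_or_odd f with hf | hf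
      · left; exact hf.neg_one_pow
      · right; exact hf.neg_one_pow
  rw [coe_apply_eq_of_smul_eq hχr hη (sqrt_ne_neg_self hd0 hr) key]
  split_ifs <;> push_cast <;> rfl

end Unramified

/-! ## §4 The ramified places: lifting an inertia element of `Γ_ℚ` that negates `√d` -/

section Ramified

variable {K : Type} [Field K] [NumberField K]

/-- **`heckeValueAt χ_gal w = 0` from an inertia element of `Γ_ℚ`.** Let `K` be a quadratic
field, `χ_gal` a rational character of `Γ_K` for `d ≠ 0`, and `w` a finite place of `K`. Suppose
that above the rational place `v₀` below `w`, every prime `𝔓₀ ∣ v₀` of `\bar ℤ` carries an inertia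
element `σ₀ ∈ I_{𝔓₀} ≤ Γ_ℚ` FIXING `√d_K` and NEGATING a square root of `d`. Then `χ_gal` is
ramified at `w` and its value extended by zero vanishes: `σ₀` fixes `√d_K`, so it is the
restriction of some `σ ∈ Γ_K` (`res(Γ_K)` is the stabiliser of `√d_K`,
`mem_range_absGaloisRestrict_of_smul_geomSqrt`); `σ` lies in the inertia group of the prime `𝔔 ∣ w`
of `\bar ℤ_K` contracting to `𝔓₀` (`comap_inertia_comap_absIntegersMap`) and negates `√d ∈ K̄`
(equivariance of `\bar ℚ → K̄`), so `χ_gal(σ) = −1 ≠ 1`.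
[cite: NeukirchANT1999, Ch. I §9 (9.4)–(9.6)] -/
theorem heckeValueAt_eq_zero_of_inertia_rat (h2 : Module.finrank ℚ K = 2)
    {χgal : absoluteGaloisGroup K →ₜ* ℂˣ} {d : ℤ} (hd0 : d ≠ 0) (hχ : IsRationalCharacterFor χgal d)
    {w : HeightOneSpectrum (𝓞 K)}
    (H : ∀ 𝔓₀ ∈ (w.under (𝓞 ℚ)).primesAbove,
      ∃ σ₀ ∈ 𝔓₀.inertia (absoluteGaloisGroup ℚ),
        σ₀ • WeierstrassCurve.geomSqrt ((NumberField.discr K : ℚ)) = WeierstrassCurve.geomSqrt ((NumberField.discr K : ℚ)) ∧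
        ∃ r₀ : AlgebraicClosure ℚ, r₀ ^ 2 = (d : AlgebraicClosure ℚ) ∧ σ₀ • r₀ = -r₀) :
    heckeValueAt χgal w = 0 := by
  obtain ⟨𝔔, h𝔔⟩ := w.primesAbove_nonempty
  haveI : 𝔔.IsPrime := h𝔔.1
  have hw : w.asIdeal.under (𝓞 ℚ) = (w.under (𝓞 ℚ)).asIdeal := rfl
  have h𝔓₀ : 𝔔.comap (absIntegersMap ℚ K) ∈ (w.under (𝓞 ℚ)).primesAbove :=
    comap_absIntegersMap_mem_primesAbove hw h𝔔
  obtain ⟨σ₀, hσ₀I, hfix, r₀, hr₀, hneg⟩ := H _ h𝔓₀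
  -- `σ₀` fixes `√d_K`, hence comes from `Γ_K`
  obtain ⟨θ, hθF, hθ⟩ := exists_sq_eq_discr_not_mem_range K h2
  obtain ⟨σ, hσ⟩ := mem_range_absGaloisRestrict_of_smul_geomSqrt h2 hθF hθ hfix
  change absGaloisRestrict ℚ K σ = σ₀ at hσ
  subst hσ
  -- `σ` is an inertia element at `𝔔`
  have hσI : σ ∈ 𝔔.inertia (absoluteGaloisGroup K) := by
    rw [← comap_inertia_comap_absIntegersMap ℚ K 𝔔, Subgroup.mem_comap]
    exact hσ₀I
  -- `σ` negates `√d ∈ K̄`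
  obtain ⟨r, hr, hχr⟩ := hχ
  set e := absClosureEmbedding ℚ K with he
  have her₀ : (e r₀) ^ 2 = (d : AlgebraicClosure K) := by rw [← map_pow, hr₀, map_intCast]
  have hσe : σ • e r₀ = -e r₀ := by
    rw [he, ← absGaloisRestrict_apply_smul ℚ K σ r₀, hneg, map_neg]
  have hpm : e r₀ = r ∨ e r₀ = -r := by
    apply sq_eq_sq_iff_eq_or_eq_neg.mp
    rw [her₀, hr]
  have hσr : σ • r = -r := by
    rcases hpm with h | h
    · rw [← h]; exact hσe
    · have h' : r = -e r₀ := by rw [h, neg_neg]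
      rw [h', smul_neg, hσe]
  have hne : χgal σ ≠ 1 := by
    intro h1
    have hval : ((χgal σ : ℂˣ) : ℂ) = 1 := by rw [h1, Units.val_one]
    rw [hχr σ, if_neg (by rw [hσr]; exact sqrt_ne_neg_self hd0 hr)] at hval
    norm_num at hval
  exact heckeValueAt_eq_zero_of_exists_mem_inertia χgal h𝔔 hσI hne

/-- For an integer `D` and the rational place `v₀`: `(√D)² = D` read through `𝓞 ℚ → \bar ℚ`.
[folklore] -/
private theorem geomSqrt_intCast_sq (D : ℤ) :
    WeierstrassCurve.geomSqrt ((D : ℚ)) ^ 2 = algebraMap (𝓞 ℚ) (AlgebraicClosure ℚ) ((D : ℤ) : 𝓞 ℚ) := by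
  rw [WeierstrassCurve.geomSqrt_sq, map_intCast, map_intCast]

/-- **An inertia element at an odd prime `ℓ` fixing `√D` and negating `√d`**, for `ℓ ∤ D`,
`ℓ ∥ d`: the inertia element of `Γ_ℚ` at `ℓ` negating `√ℓ` (`ℚ(√ℓ)` is ramified at `ℓ`,
`exists_mem_inertia_smul_eq_neg_of_sq_eq_prime`) fixes the square roots of the `ℓ`-units `D` and
`d/ℓ` (`smul_eq_of_mem_inertia_of_sq_eq_of_notMem`), hence negates `√d = √ℓ · √(d/ℓ)`.
[cite: NeukirchANT1999, Ch. I §8 and §9 (9.4)–(9.6)] -/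
theorem exists_mem_inertia_rat_of_odd {ℓ : ℕ} (hℓ : ℓ.Prime) (hℓ2 : ℓ ≠ 2) {D d : ℤ}
    (hD : ¬ (ℓ : ℤ) ∣ D) (hℓd : (ℓ : ℤ) ∣ d) (hℓd' : ¬ (ℓ : ℤ) ∣ d / ℓ)
    {v₀ : HeightOneSpectrum (𝓞 ℚ)} (hv₀ : (ℓ : 𝓞 ℚ) ∈ v₀.asIdeal)
    {𝔓₀ : Ideal (absIntegers (𝓞 ℚ) ℚ)} (h𝔓₀ : 𝔓₀ ∈ v₀.primesAbove) :
    ∃ σ₀ ∈ 𝔓₀.inertia (absoluteGaloisGroup ℚ),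
      σ₀ • WeierstrassCurve.geomSqrt ((D : ℚ)) = WeierstrassCurve.geomSqrt ((D : ℚ)) ∧
      ∃ r₀ : AlgebraicClosure ℚ, r₀ ^ 2 = (d : AlgebraicClosure ℚ) ∧ σ₀ • r₀ = -r₀ := by
  set s := WeierstrassCurve.geomSqrt ((ℓ : ℚ)) with hsdef
  have hs : s ^ 2 = (ℓ : AlgebraicClosure ℚ) := by rw [hsdef, WeierstrassCurve.geomSqrt_sq, map_natCast]
  obtain ⟨σ₀, hI, hneg⟩ := exists_mem_inertia_smul_eq_neg_of_sq_eq_prime hℓ hs hv₀ h𝔓₀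
  have h2 : (2 : 𝓞 ℚ) ∉ v₀.asIdeal := two_not_mem_of_natCast_prime_mem hℓ hℓ2 hv₀
  have hfixD : σ₀ • WeierstrassCurve.geomSqrt ((D : ℚ)) = WeierstrassCurve.geomSqrt ((D : ℚ)) :=
    smul_eq_of_mem_inertia_of_sq_eq_of_notMem v₀ h𝔓₀ hI h2
      (intCast_not_mem_asIdeal_of_not_dvd hℓ hv₀ hD) (geomSqrt_intCast_sq D)
  set t := WeierstrassCurve.geomSqrt (((d / ℓ : ℤ)) : ℚ) with htdef
  have hfixt : σ₀ • t = t :=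
    smul_eq_of_mem_inertia_of_sq_eq_of_notMem v₀ h𝔓₀ hI h2
      (intCast_not_mem_asIdeal_of_not_dvd hℓ hv₀ hℓd') (geomSqrt_intCast_sq (d / ℓ))
  have ht : t ^ 2 = ((d / ℓ : ℤ) : AlgebraicClosure ℚ) := by rw [htdef, WeierstrassCurve.geomSqrt_sq, map_intCast]
  refine ⟨σ₀, hI, hfixD, s * t, ?_, ?_⟩
  · rw [mul_pow, hs, ht]
    have hmul : ((ℓ : ℤ) * (d / ℓ) : ℤ) = d := Int.mul_ediv_cancel' hℓd
    exact_mod_cast hmul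
  · rw [smul_mul', hneg, hfixt, neg_mul]

/-- No odd prime square divides a fundamental discriminant. [cite: Cox2013, §5.B (5.12) (field discriminants)] -/
theorem not_sq_dvd_of_isFundamental {d : ℤ}
    (hd : (d % 4 = 1 ∧ Squarefree d ∧ d ≠ 1) ∨
      (4 ∣ d ∧ (d / 4 % 4 = 2 ∨ d / 4 % 4 = 3) ∧ Squarefree (d / 4)))
    {ℓ : ℕ} (hℓ : ℓ.Prime) (hℓ2 : ℓ ≠ 2) : ¬ (ℓ : ℤ) ^ 2 ∣ d := by
  have hℓp : Prime (ℓ : ℤ) := Nat.prime_iff_prime_int.mp hℓ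
  have hnu : ¬ IsUnit (ℓ : ℤ) := hℓp.not_unit
  intro h
  rcases hd with ⟨_, hsq, _⟩ | ⟨h4, _, hsq⟩
  · exact hnu (hsq (ℓ : ℤ) (by rwa [← sq]))
  · obtain ⟨m, hm⟩ := h4
    have hm' : d / 4 = m := by rw [hm]; simp
    rw [hm'] at hsq
    have hcop : IsCoprime ((ℓ : ℤ) ^ 2) 4 := by
      have h2 : IsCoprime (ℓ : ℤ) 2 :=
        (Nat.coprime_primes hℓ Nat.prime_two).mpr hℓ2 |> Nat.Coprime.isCoprime |> fun h => by
          exact_mod_cast h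
      have : (4 : ℤ) = 2 ^ 2 := by norm_num
      rw [this]
      exact IsCoprime.pow h2
    have hdvd : (ℓ : ℤ) ^ 2 ∣ m := hcop.dvd_of_dvd_mul_left (by rw [← hm]; exact h)
    exact hnu (hsq (ℓ : ℤ) (by rwa [← sq]))

/-- **At an odd prime `ℓ ∣ c`, the rational character for `d₁` is ramified above `ℓ` and
`heckeValueAt χ_gal w = 0`** for every place `w ∣ ℓ` of the quadratic field `K`, when
`d₁ d₂ = d_K c²` with `d₁, d₂` fundamental discriminants: `ℓ ∥ d₁`, `ℓ ∥ d₂`, `ℓ ∤ d_K` (an odd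
prime square divides no fundamental discriminant), and `exists_mem_inertia_rat_of_odd` /
`heckeValueAt_eq_zero_of_inertia_rat` apply. This is the vanishing "`χ(𝔞) = 0` for `𝔞` not
prime to the conductor `c`" of the genus character (Gross 2004 §3; Nekovář (0.5) "extended by
zero"). [cite: Gross2004, §3 p. 40] [cite: Nekovar1995, §3.4] -/
theorem heckeValueAt_eq_zero_of_isRationalCharacterFor_of_odd_dvd (h2 : Module.finrank ℚ K = 2)
    {χgal : absoluteGaloisGroup K →ₜ* ℂˣ} {d₁ d₂ : ℤ} {c : ℕ} (hχ : IsRationalCharacterFor χgal d₁)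
    (hd₁ : (d₁ % 4 = 1 ∧ Squarefree d₁ ∧ d₁ ≠ 1) ∨
      (4 ∣ d₁ ∧ (d₁ / 4 % 4 = 2 ∨ d₁ / 4 % 4 = 3) ∧ Squarefree (d₁ / 4)))
    (hd₂ : (d₂ % 4 = 1 ∧ Squarefree d₂ ∧ d₂ ≠ 1) ∨
      (4 ∣ d₂ ∧ (d₂ / 4 % 4 = 2 ∨ d₂ / 4 % 4 = 3) ∧ Squarefree (d₂ / 4)))
    (hD : d₁ * d₂ = NumberField.discr K * (c : ℤ) ^ 2)
    {ℓ : ℕ} (hℓ : ℓ.Prime) (hℓ2 : ℓ ≠ 2) (hℓc : (ℓ : ℤ) ∣ c)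
    {w : HeightOneSpectrum (𝓞 K)} (hw : (ℓ : 𝓞 K) ∈ w.asIdeal) : heckeValueAt χgal w = 0 := by
  have hℓp : Prime (ℓ : ℤ) := Nat.prime_iff_prime_int.mp hℓ
  have h1 := not_sq_dvd_of_isFundamental hd₁ hℓ hℓ2
  have h2' := not_sq_dvd_of_isFundamental hd₂ hℓ hℓ2
  -- `ℓ² ∣ d₁ d₂`, so `ℓ ∣ d₁` and `ℓ ∣ d₂`
  have hsq : (ℓ : ℤ) ^ 2 ∣ d₁ * d₂ := by
    rw [hD]; exact Dvd.dvd.mul_left (pow_dvd_pow_of_dvd hℓc 2) _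
  have hℓd₁ : (ℓ : ℤ) ∣ d₁ := by
    by_contra h
    have hcop : IsCoprime ((ℓ : ℤ) ^ 2) d₁ := (IsCoprime.pow_left ((hℓp.coprime_iff_not_dvd).mpr h))
    exact h2' (hcop.dvd_of_dvd_mul_left hsq)
  have hℓd₂ : (ℓ : ℤ) ∣ d₂ := by
    by_contra h
    have hcop : IsCoprime ((ℓ : ℤ) ^ 2) d₂ := (IsCoprime.pow_left ((hℓp.coprime_iff_not_dvd).mpr h))
    exact h1 (hcop.dvd_of_dvd_mul_right hsq)
  rcases id hℓd₁ with ⟨m₁, hm₁⟩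
  rcases id hℓd₂ with ⟨m₂, hm₂⟩
  have hℓ0 : (ℓ : ℤ) ≠ 0 := by exact_mod_cast hℓ.ne_zero
  have hm₁' : ¬ (ℓ : ℤ) ∣ m₁ := fun h => h1 (by rw [hm₁, sq]; exact mul_dvd_mul_left _ h)
  have hm₂' : ¬ (ℓ : ℤ) ∣ m₂ := fun h => h2' (by rw [hm₂, sq]; exact mul_dvd_mul_left _ h)
  have hℓd₁' : ¬ (ℓ : ℤ) ∣ d₁ / ℓ := by
    rwa [hm₁, Int.mul_ediv_cancel_left _ hℓ0]
  -- `ℓ ∤ d_K`: otherwise `ℓ³ ∣ d₁ d₂ = ℓ² m₁ m₂`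
  have hK : ¬ (ℓ : ℤ) ∣ NumberField.discr K := by
    intro h
    have h3 : (ℓ : ℤ) ^ 3 ∣ d₁ * d₂ := by
      rw [hD, show ((ℓ : ℤ)) ^ 3 = ℓ * ℓ ^ 2 by ring]
      exact mul_dvd_mul h (pow_dvd_pow_of_dvd hℓc 2)
    rw [hm₁, hm₂, show (ℓ : ℤ) * m₁ * (ℓ * m₂) = ℓ ^ 2 * (m₁ * m₂) by ring,
      show ((ℓ : ℤ)) ^ 3 = ℓ ^ 2 * ℓ by ring] at h3
    have hℓ20 : (ℓ : ℤ) ^ 2 ≠ 0 := pow_ne_zero _ hℓ0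
    rcases hℓp.dvd_or_dvd ((mul_dvd_mul_iff_left hℓ20).mp h3) with h' | h'
    · exact hm₁' h'
    · exact hm₂' h'
  have hd0 : d₁ ≠ 0 := by
    intro h0
    apply hm₁'
    rw [h0] at hm₁
    rcases mul_eq_zero.mp hm₁.symm with h | h
    · exact absurd h hℓ0
    · rw [h]; exact dvd_zero _
  refine heckeValueAt_eq_zero_of_inertia_rat h2 hd0 hχ fun 𝔓₀ h𝔓₀ => ?_
  have hv₀ : (ℓ : 𝓞 ℚ) ∈ (w.under (𝓞 ℚ)).asIdeal := by
    change (ℓ : 𝓞 ℚ) ∈ w.asIdeal.under (𝓞 ℚ)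
    rw [Ideal.under_def, Ideal.mem_comap, map_natCast]
    exact hw
  exact exists_mem_inertia_rat_of_odd hℓ hℓ2 hK hℓd₁ hℓd₁' hv₀ h𝔓₀

end Ramified

/-! ## §5 The ramified places above `2` (case `2 ∣ c`): square roots of `−1, ±2` in `ℚ(ζ₈)` -/

section Dyadic

/-- **`√−1, √2, √−2 ∈ ℚ(ζ₈) ⊆ \bar ℚ` and the action of `Γ_ℚ` on them through the mod-`8`
cyclotomic character.** There are `s₁, s₂, s₃ ∈ \bar ℚ` with `s₁² = −1`, `s₂² = 2`, `s₃² = −2`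
such that every `γ ∈ Γ_ℚ` with `χ₈(γ) = 3` acts by `s₁ ↦ −s₁`, `s₂ ↦ −s₂`, `s₃ ↦ s₃`, with
`χ₈(γ) = 5` by `s₁ ↦ s₁`, `s₂ ↦ −s₂`, `s₃ ↦ −s₃`, and with `χ₈(γ) = 7` by `s₁ ↦ −s₁`, `s₂ ↦ s₂`,
`s₃ ↦ −s₃` (`s₁ = ζ²`, `s₂ = ζ + ζ⁷`, `s₃ = ζ + ζ³` for a primitive `8`-th root of unity `ζ`;
the values `χ₋₄(a)`, `χ₈(a)`, `χ₋₈(a)` of the three quadratic characters of conductor dividing `8`).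
[cite: IrelandRosen1990, Ch. 6 §2 (the quadratic character of 2: (ζ + ζ⁻¹)² = 2)] -/
theorem exists_sqrt_negOne_two_negTwo :
    ∃ s₁ s₂ s₃ : AlgebraicClosure ℚ, s₁ ^ 2 = -1 ∧ s₂ ^ 2 = 2 ∧ s₃ ^ 2 = -2 ∧
      ∀ γ : absoluteGaloisGroup ℚ,
        (((modNCyclotomicCharacter ℚ 8 γ : ZMod 8)).val = 3 →
          γ • s₁ = -s₁ ∧ γ • s₂ = -s₂ ∧ γ • s₃ = s₃) ∧
        (((modNCyclotomicCharacter ℚ 8 γ : ZMod 8)).val = 5 →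
          γ • s₁ = s₁ ∧ γ • s₂ = -s₂ ∧ γ • s₃ = -s₃) ∧
        (((modNCyclotomicCharacter ℚ 8 γ : ZMod 8)).val = 7 →
          γ • s₁ = -s₁ ∧ γ • s₂ = s₂ ∧ γ • s₃ = -s₃) := by
  haveI : NeZero ((8 : ℕ) : AlgebraicClosure ℚ) :=
    NeZero.nat_of_injective (algebraMap ℚ (AlgebraicClosure ℚ)).injective
  obtain ⟨ζ, hζ⟩ := HasEnoughRootsOfUnity.exists_primitiveRoot (AlgebraicClosure ℚ) 8
  have h8 : ζ ^ 8 = 1 := hζ.pow_eq_one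
  have h4 : ζ ^ 4 = -1 := by
    have hne : ζ ^ 4 ≠ 1 := hζ.pow_ne_one_of_pos_of_lt (by norm_num) (by norm_num)
    have h0 : (ζ ^ 4 - 1) * (ζ ^ 4 + 1) = 0 := by
      have : (ζ ^ 4 - 1) * (ζ ^ 4 + 1) = ζ ^ 8 - 1 := by ring
      rw [this, h8, sub_self]
    rcases mul_eq_zero.mp h0 with h | h
    · exact absurd (sub_eq_zero.mp h) hne
    · exact eq_neg_of_add_eq_zero_left h
  have hmod : ∀ n : ℕ, ζ ^ n = ζ ^ (n % 8) := fun n ↦ by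
    conv_lhs => rw [← Nat.mod_add_div n 8, pow_add, pow_mul, h8, one_pow, mul_one]
  -- reduced powers
  have h5 : ζ ^ 5 = -ζ := by
    rw [show (5 : ℕ) = 4 + 1 by norm_num, pow_add, h4, pow_one]; ring
  have h6 : ζ ^ 6 = -ζ ^ 2 := by
    rw [show (6 : ℕ) = 4 + 2 by norm_num, pow_add, h4]; ring
  have h7 : ζ ^ 7 = -ζ ^ 3 := by
    rw [show (7 : ℕ) = 4 + 3 by norm_num, pow_add, h4]; ring
  have hact : ∀ (γ : absoluteGaloisGroup ℚ) (k : ℕ),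
      γ • ζ ^ k = ζ ^ ((k * ((modNCyclotomicCharacter ℚ 8 γ : ZMod 8)).val) % 8) := by
    intro γ k
    rw [smul_pow', modNCyclotomicCharacter_spec ℚ 8 γ ζ h8, ← pow_mul, ← hmod, mul_comm]
  refine ⟨ζ ^ 2, ζ + ζ ^ 7, ζ + ζ ^ 3, ?_, ?_, ?_, fun γ ↦ ⟨fun ha ↦ ?_, fun ha ↦ ?_, fun ha ↦ ?_⟩⟩
  · rw [← pow_mul, h4]
  · have : (ζ + ζ ^ 7) ^ 2 = ζ ^ 2 + 2 * ζ ^ 8 + ζ ^ 4 * ζ ^ 4 * ζ ^ 6 := by ring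
    rw [this, h8, h4, h6]; ring
  · have : (ζ + ζ ^ 3) ^ 2 = ζ ^ 2 + 2 * ζ ^ 4 + ζ ^ 6 := by ring
    rw [this, h4, h6]; ring
  · have e1 : γ • ζ = ζ ^ 3 := by have := hact γ 1; rwa [pow_one, ha] at this
    refine ⟨?_, ?_, ?_⟩
    · rw [hact γ 2, ha, h6]
    · rw [smul_add, e1, hact γ 7, ha]; norm_num; rw [h5, h7]; ring
    · rw [smul_add, e1, hact γ 3, ha]; norm_num; ring
  · have e1 : γ • ζ = ζ ^ 5 := by have := hact γ 1; rwa [pow_one, ha] at this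
    refine ⟨?_, ?_, ?_⟩
    · rw [hact γ 2, ha]
    · rw [smul_add, e1, hact γ 7, ha]; norm_num; rw [h5, h7]; ring
    · rw [smul_add, e1, hact γ 3, ha]; norm_num; rw [h5, h7]; ring
  · have e1 : γ • ζ = ζ ^ 7 := by have := hact γ 1; rwa [pow_one, ha] at this
    refine ⟨?_, ?_, ?_⟩
    · rw [hact γ 2, ha, h6]
    · rw [smul_add, e1, hact γ 7, ha]; norm_num; ring
    · rw [smul_add, e1, hact γ 3, ha]; norm_num; rw [h5, h7]

/-- **An inertia element of `Γ_ℚ` at `2` with prescribed mod-`8` cyclotomic character**: for a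
prime `𝔓₀` of `\bar ℤ` above `2` and `a` odd there is `τ ∈ I_{𝔓₀}` with `χ₈(τ) = a`
(`ℚ(ζ₈)/ℚ` is totally ramified at `2`; the tree's `exists_mem_inertia_modNCyclotomicCharacter_eq`).
[cite: NeukirchANT1999, Ch. I (10.3)–(10.4)] -/
theorem exists_mem_inertia_modEight_val_eq {v₀ : HeightOneSpectrum (𝓞 ℚ)}
    (hv₀ : (2 : 𝓞 ℚ) ∈ v₀.asIdeal) {𝔓₀ : Ideal (absIntegers (𝓞 ℚ) ℚ)} (h𝔓₀ : 𝔓₀ ∈ v₀.primesAbove)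
    {a : ℕ} (ha : a.Coprime 8) (ha8 : a < 8) :
    ∃ τ ∈ 𝔓₀.inertia (absoluteGaloisGroup ℚ),
      ((modNCyclotomicCharacter ℚ 8 τ : ZMod 8)).val = a := by
  haveI : Fact (Nat.Prime 2) := ⟨Nat.prime_two⟩
  have hgen : Rat.HeightOneSpectrum.natGenerator v₀ = 2 := by
    have hv' := (natCast_mem_asIdeal_iff_eq_primesEquiv_symm v₀ Nat.prime_two).mp
      (by exact_mod_cast hv₀)
    change ((Rat.HeightOneSpectrum.primesEquiv v₀ : Nat.Primes) : ℕ) = 2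
    rw [hv', Equiv.apply_symm_apply]
  have hm : (8 : ℕ) = 2 ^ (2 + 1) * 1 := by norm_num
  have ha1 : ZMod.unitsMap (Dvd.intro_left _ hm.symm) (ZMod.unitOfCoprime a ha) = 1 :=
    Subsingleton.elim _ _
  obtain ⟨τ, hτI, hτχ⟩ := exists_mem_inertia_modNCyclotomicCharacter_eq (v := v₀) hm
    (by norm_num) hgen h𝔓₀ ha1
  refine ⟨τ, hτI, ?_⟩
  rw [hτχ, ZMod.coe_unitOfCoprime, ZMod.val_natCast, Nat.mod_eq_of_lt ha8]

omit [NumberField K] in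
/-- `γ ∈ Γ_K` fixes `2 ∈ K̄`. [folklore] -/
private theorem smul_two_algebraicClosure (γ : absoluteGaloisGroup K) :
    γ • (2 : AlgebraicClosure K) = 2 := by
  rw [absoluteGaloisGroup.smul_def]; exact map_ofNat _ 2

/-- **Transport of a sign along `√x = ± 2 √u √n`**: if `σ s = ε s`, `σ t = t` with `s² = u`,
`t² = n`, and `y² = x = 4un`, then `σ y = ε y`. [folklore] -/
private theorem smul_eq_of_sq_eq_four_mul {σ : absoluteGaloisGroup ℚ} {s t y : AlgebraicClosure ℚ}
    {u n x ε : ℤ} (hs : s ^ 2 = (u : AlgebraicClosure ℚ)) (ht : t ^ 2 = (n : AlgebraicClosure ℚ))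
    (hx : x = 4 * u * n) (hy : y ^ 2 = (x : AlgebraicClosure ℚ))
    (hσs : σ • s = (ε : AlgebraicClosure ℚ) * s) (hσt : σ • t = t) :
    σ • y = (ε : AlgebraicClosure ℚ) * y := by
  have h2st : (2 * s * t) ^ 2 = (x : AlgebraicClosure ℚ) := by
    rw [hx]; push_cast; rw [← hs, ← ht]; ring
  have hσ2st : σ • (2 * s * t) = (ε : AlgebraicClosure ℚ) * (2 * s * t) := by
    rw [smul_mul', smul_mul', smul_two_algebraicClosure, hσs, hσt]; ring
  have hpm : y = 2 * s * t ∨ y = -(2 * s * t) := by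
    apply sq_eq_sq_iff_eq_or_eq_neg.mp; rw [hy, h2st]
  rcases hpm with h | h
  · rw [h]; exact hσ2st
  · rw [h, smul_neg, hσ2st]; ring

/-- **Inertia above `2` fixes `√n` for `n ≡ 1 (mod 4)`** (`ℚ(√n)/ℚ` is unramified at `2`;
`smul_eq_self_of_mem_inertia_of_sq_eq`). [cite: NeukirchANT1999, Ch. I §8] -/
theorem smul_eq_of_emod_four_eq_one {v₀ : HeightOneSpectrum (𝓞 ℚ)} (hv₀ : (2 : 𝓞 ℚ) ∈ v₀.asIdeal)
    {𝔓₀ : Ideal (absIntegers (𝓞 ℚ) ℚ)} (h𝔓₀ : 𝔓₀ ∈ v₀.primesAbove)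
    {τ : absoluteGaloisGroup ℚ} (hτ : τ ∈ 𝔓₀.inertia (absoluteGaloisGroup ℚ))
    {n : ℤ} (hn : n % 4 = 1) {t : AlgebraicClosure ℚ} (ht : t ^ 2 = (n : AlgebraicClosure ℚ)) :
    τ • t = t := by
  haveI : 𝔓₀.IsPrime := h𝔓₀.1
  have h2𝔓 : ((2 : ℤ) : absIntegers (𝓞 ℚ) ℚ) ∈ 𝔓₀ :=
    intCast_mem_of_mem_primesAbove (by exact_mod_cast hv₀) h𝔓₀
  have hn𝔓 : ((n : ℤ) : absIntegers (𝓞 ℚ) ℚ) ∉ 𝔓₀ :=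
    intCast_not_mem_of_not_dvd Nat.prime_two (by exact_mod_cast h2𝔓) (by omega)
  exact smul_eq_self_of_mem_inertia_of_sq_eq (k := n / 4) (by omega) ht hn𝔓 hτ

/-! ### The dyadic arithmetic of `d₁ d₂ = d_K c²` with `2 ∣ c` -/

/-- The `2`-adic valuation of a non-zero integer from two divisibilities. [folklore] -/
private theorem padicValInt_two_eq {a : ℤ} (ha : a ≠ 0) {n : ℕ} (h1 : (2 : ℤ) ^ n ∣ a)
    (h2 : ¬ (2 : ℤ) ^ (n + 1) ∣ a) : padicValInt 2 a = n := by
  haveI : Fact (Nat.Prime 2) := ⟨Nat.prime_two⟩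
  have h1' := ((padicValInt_dvd_iff n a).mp (by exact_mod_cast h1)).resolve_left ha
  have h2' : ¬ n + 1 ≤ padicValInt 2 a := fun h =>
    h2 (by exact_mod_cast (padicValInt_dvd_iff (n + 1) a).mpr (Or.inr h))
  omega

/-- **The dyadic shape of a fundamental discriminant**: `v₂(d) = 0` with `d ≡ 1 (mod 4)`, or
`v₂(d) = 2` with `d/4 ≡ 3 (mod 4)`, or `v₂(d) = 3` with `d/8` odd.
[cite: Cox2013, §5.B (5.12) (field discriminants)] -/
theorem dyadic_of_isFundamental {d : ℤ}
    (hd : (d % 4 = 1 ∧ Squarefree d ∧ d ≠ 1) ∨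
      (4 ∣ d ∧ (d / 4 % 4 = 2 ∨ d / 4 % 4 = 3) ∧ Squarefree (d / 4))) :
    (padicValInt 2 d = 0 ∧ d % 4 = 1) ∨ (padicValInt 2 d = 2 ∧ 4 ∣ d ∧ d / 4 % 4 = 3) ∨
      (padicValInt 2 d = 3 ∧ 8 ∣ d ∧ d / 8 % 2 = 1) := by
  rcases hd with ⟨h1, _, _⟩ | ⟨h4, h23, _⟩
  · left
    refine ⟨padicValInt_two_eq (by omega) (by simp) ?_, h1⟩
    rw [pow_one]; omega
  · rcases h23 with h2 | h3
    · right; right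
      have hd0 : d ≠ 0 := by omega
      refine ⟨padicValInt_two_eq hd0 ?_ ?_, by omega, by omega⟩
      · exact ⟨d / 8, by omega⟩
      · rintro ⟨k, hk⟩; omega
    · right; left
      have hd0 : d ≠ 0 := by omega
      refine ⟨padicValInt_two_eq hd0 ?_ ?_, h4, h3⟩
      · exact ⟨d / 4, by omega⟩
      · rintro ⟨k, hk⟩; omega

/-- Cancelling the powers of `2`: from `d₁ d₂ = D c²` with `d₁ = 2^i x`, `d₂ = 2^j y`, `D = 2^k z`,
`c = 2^l w` and `i + j = k + 2l`, the odd parts satisfy `x y = z w²`. [folklore] -/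
private theorem oddParts_rel {d₁ d₂ D C x y z w : ℤ} {i j k l : ℕ} (hrel : d₁ * d₂ = D * C ^ 2)
    (h₁ : d₁ = 2 ^ i * x) (h₂ : d₂ = 2 ^ j * y) (hD : D = 2 ^ k * z) (hC : C = 2 ^ l * w)
    (hv : i + j = k + 2 * l) : x * y = z * w ^ 2 := by
  rw [h₁, h₂, hD, hC] at hrel
  have h : (2 : ℤ) ^ (i + j) * (x * y) = (2 : ℤ) ^ (k + 2 * l) * (z * w ^ 2) := by
    rw [pow_add, pow_add, pow_mul']; linear_combination hrel
  rw [hv] at h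
  exact mul_left_cancel₀ (pow_ne_zero _ two_ne_zero) h

/-- **The dyadic configuration of a factorization `d₁ d₂ = d_K c²` with `2 ∣ c`** (`d₁, d₂, d_K`
fundamental discriminants). Both `d₁` and `d₂` are divisible by `4`; writing `d₁ = 4 u₁ n₁` with
`u₁ ∈ {−1, 2, −2}`, `n₁ ≡ 1 (mod 4)`, and similarly `d_K` when `4 ∣ d_K`, the `2`-primary parts of
`d₁` and `d_K` differ, so that some `a ∈ {3, 5, 7}` has `χ_{u_K}(a) = 1` and `χ_{u₁}(a) = −1`
(quadratic characters of conductor dividing `8`). The conclusion lists `a` together with the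
sign pattern of `exists_sqrt_negOne_two_negTwo`. [cite: Cox2013, §5.B (5.12) and Lemma 1.14] -/
theorem dyadic_configuration {d₁ d₂ D : ℤ} {c : ℕ}
    (hd₁ : (d₁ % 4 = 1 ∧ Squarefree d₁ ∧ d₁ ≠ 1) ∨
      (4 ∣ d₁ ∧ (d₁ / 4 % 4 = 2 ∨ d₁ / 4 % 4 = 3) ∧ Squarefree (d₁ / 4)))
    (hd₂ : (d₂ % 4 = 1 ∧ Squarefree d₂ ∧ d₂ ≠ 1) ∨
      (4 ∣ d₂ ∧ (d₂ / 4 % 4 = 2 ∨ d₂ / 4 % 4 = 3) ∧ Squarefree (d₂ / 4)))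
    (hDf : (D % 4 = 1 ∧ Squarefree D ∧ D ≠ 1) ∨
      (4 ∣ D ∧ (D / 4 % 4 = 2 ∨ D / 4 % 4 = 3) ∧ Squarefree (D / 4)))
    (hrel : d₁ * d₂ = D * (c : ℤ) ^ 2) (hc0 : c ≠ 0) (h2c : 2 ∣ c) :
    ∃ (a : ℕ) (u₁ n₁ : ℤ), (a = 3 ∨ a = 5 ∨ a = 7) ∧ d₁ = 4 * u₁ * n₁ ∧ n₁ % 4 = 1 ∧
      ((a = 3 ∧ (u₁ = -1 ∨ u₁ = 2)) ∨ (a = 5 ∧ (u₁ = 2 ∨ u₁ = -2)) ∨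
        (a = 7 ∧ (u₁ = -1 ∨ u₁ = -2))) ∧
      (D % 4 = 1 ∨ ∃ u n : ℤ, D = 4 * u * n ∧ n % 4 = 1 ∧
        ((a = 3 ∧ u = -2) ∨ (a = 5 ∧ u = -1) ∨ (a = 7 ∧ u = 2))) := by
  haveI : Fact (Nat.Prime 2) := ⟨Nat.prime_two⟩
  -- the `2`-part of `c`
  set C : ℤ := (c : ℤ) with hCdef
  have hC0 : C ≠ 0 := by rw [hCdef]; exact_mod_cast hc0
  set l : ℕ := padicValInt 2 C with hl
  have hlC : (2 : ℤ) ^ l ∣ C := by exact_mod_cast padicValInt_dvd C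
  obtain ⟨w, hw⟩ := hlC
  have hwodd : w % 2 = 1 := by
    by_contra hev
    have h2w : (2 : ℤ) ∣ w := by omega
    have : (2 : ℤ) ^ (l + 1) ∣ C := by
      rw [hw, pow_succ]; exact mul_dvd_mul_left _ h2w
    have := ((padicValInt_dvd_iff (l + 1) C).mp (by exact_mod_cast this)).resolve_left hC0
    omega
  have hl1 : 1 ≤ l := by
    have : (2 : ℤ) ^ 1 ∣ C := by rw [pow_one, hCdef]; exact_mod_cast h2c
    exact ((padicValInt_dvd_iff 1 C).mp (by exact_mod_cast this)).resolve_left hC0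
  have hw2 : w ^ 2 % 4 = 1 := Int.sq_mod_four_eq_one_of_odd (Int.odd_iff.mpr hwodd)
  -- valuations: `v(d₁) + v(d₂) = v(D) + 2 l`
  have hd₁0 : d₁ ≠ 0 := by rcases hd₁ with ⟨h, _⟩ | ⟨_, h, _⟩ <;> omega
  have hd₂0 : d₂ ≠ 0 := by rcases hd₂ with ⟨h, _⟩ | ⟨_, h, _⟩ <;> omega
  have hD0 : D ≠ 0 := by rcases hDf with ⟨h, _⟩ | ⟨_, h, _⟩ <;> omega
  have hval : padicValInt 2 d₁ + padicValInt 2 d₂ = padicValInt 2 D + 2 * l := by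
    have h := congrArg (padicValInt 2) hrel
    rw [padicValInt.mul hd₁0 hd₂0, sq, ← mul_assoc, padicValInt.mul (mul_ne_zero hD0 hC0) hC0,
      padicValInt.mul hD0 hC0] at h
    omega
  have T₁ := dyadic_of_isFundamental hd₁
  have T₂ := dyadic_of_isFundamental hd₂
  have TD := dyadic_of_isFundamental hDf
  -- `4 ∣ d₁`: the case `v(d₁) = 0` forces `v(d₂) = 2`, `v(D) = 0`, `l = 1`, and then
  -- `d₁ (d₂/4) = D (c/2)²` is `1 · 3 ≡ 1 · 1 (mod 4)`, absurd
  rcases T₁ with ⟨v₁, r₁⟩ | ⟨v₁, e₁, r₁⟩ | ⟨v₁, e₁, r₁⟩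
  · exfalso
    rcases T₂ with ⟨v₂, r₂⟩ | ⟨v₂, e₂, r₂⟩ | ⟨v₂, e₂, r₂⟩
    · omega
    · rcases TD with ⟨vD, rD⟩ | ⟨vD, eD, rD⟩ | ⟨vD, eD, rD⟩
      · have hl' : l = 1 := by omega
        have key := oddParts_rel (x := d₁) (y := d₂ / 4) (z := D) (i := 0) (j := 2) (k := 0)
          hrel (by ring) (by omega) (by ring) hw (by omega)
        have h1 : (d₁ * (d₂ / 4)) % 4 = 3 := by rw [Int.mul_emod, r₁, r₂]; norm_num
        have h2 : (D * w ^ 2) % 4 = 1 := by rw [Int.mul_emod, rD, hw2]; norm_num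
        omega
      · omega
      · omega
    · omega
  · -- `d₁ = 4 m₁`, `m₁ ≡ 3 (mod 4)`: `u₁ = -1`, `n₁ = -m₁`
    rcases T₂ with ⟨v₂, r₂⟩ | ⟨v₂, e₂, r₂⟩ | ⟨v₂, e₂, r₂⟩
    · exfalso
      rcases TD with ⟨vD, rD⟩ | ⟨vD, eD, rD⟩ | ⟨vD, eD, rD⟩
      · have key := oddParts_rel (x := d₁ / 4) (y := d₂) (z := D) (i := 2) (j := 0) (k := 0)
          hrel (by omega) (by ring) (by ring) hw (by omega)
        have h1 : (d₁ / 4 * d₂) % 4 = 3 := by rw [Int.mul_emod, r₁, r₂]; norm_num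
        have h2 : (D * w ^ 2) % 4 = 1 := by rw [Int.mul_emod, rD, hw2]; norm_num
        omega
      · omega
      · omega
    · rcases TD with ⟨vD, rD⟩ | ⟨vD, eD, rD⟩ | ⟨vD, eD, rD⟩
      · -- `(2,2,0)`: `a = 3`
        exact ⟨3, -1, -(d₁ / 4), Or.inl rfl, by omega, by omega,
          Or.inl ⟨rfl, Or.inl rfl⟩, Or.inl rD⟩
      · -- `(2,2,2)`: impossible, `3 · 3 ≢ 3 (mod 4)`
        exfalso
        have key := oddParts_rel (x := d₁ / 4) (y := d₂ / 4) (z := D / 4) (i := 2) (j := 2)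
          (k := 2) hrel (by omega) (by omega) (by omega) hw (by omega)
        have h1 : (d₁ / 4 * (d₂ / 4)) % 4 = 1 := by rw [Int.mul_emod, r₁, r₂]; norm_num
        have h2 : (D / 4 * w ^ 2) % 4 = 3 := by rw [Int.mul_emod, rD, hw2]; norm_num
        omega
      · omega
    · rcases TD with ⟨vD, rD⟩ | ⟨vD, eD, rD⟩ | ⟨vD, eD, rD⟩
      · omega
      · omega
      · -- `(2,3,3)`: `u₁ = -1`, `u_K = ± 2`
        by_cases hK : D / 8 % 4 = 1
        · exact ⟨7, -1, -(d₁ / 4), Or.inr (Or.inr rfl), by omega, by omega,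
            Or.inr (Or.inr ⟨rfl, Or.inl rfl⟩),
            Or.inr ⟨2, D / 8, by omega, hK, Or.inr (Or.inr ⟨rfl, rfl⟩)⟩⟩
        · exact ⟨3, -1, -(d₁ / 4), Or.inl rfl, by omega, by omega,
            Or.inl ⟨rfl, Or.inl rfl⟩,
            Or.inr ⟨-2, -(D / 8), by omega, by omega, Or.inl ⟨rfl, rfl⟩⟩⟩
  · -- `d₁ = 8 n₁`, `n₁` odd: `u₁ = ± 2`
    rcases T₂ with ⟨v₂, r₂⟩ | ⟨v₂, e₂, r₂⟩ | ⟨v₂, e₂, r₂⟩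
    · exfalso; omega
    · rcases TD with ⟨vD, rD⟩ | ⟨vD, eD, rD⟩ | ⟨vD, eD, rD⟩
      · omega
      · omega
      · -- `(3,2,3)`: `n₁ · 3 ≡ n_K (mod 4)`, opposite types
        have key := oddParts_rel (x := d₁ / 8) (y := d₂ / 4) (z := D / 8) (i := 3) (j := 2)
          (k := 3) hrel (by omega) (by omega) (by omega) hw (by omega)
        have h2 : (D / 8 * w ^ 2) % 4 = D / 8 % 4 := by
          rw [Int.mul_emod, hw2, mul_one, Int.emod_emod_of_dvd _ (by norm_num)]
        have h1 : (d₁ / 8 * (d₂ / 4)) % 4 = (d₁ / 8 % 4 * 3) % 4 := by rw [Int.mul_emod, r₂]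
        by_cases hK : D / 8 % 4 = 1
        · -- `u_K = 2`, `a = 7`, then `n₁ ≡ 3`, `u₁ = -2`
          have hn : d₁ / 8 % 4 = 3 := by omega
          exact ⟨7, -2, -(d₁ / 8), Or.inr (Or.inr rfl), by omega, by omega,
            Or.inr (Or.inr ⟨rfl, Or.inr rfl⟩),
            Or.inr ⟨2, D / 8, by omega, hK, Or.inr (Or.inr ⟨rfl, rfl⟩)⟩⟩
        · -- `u_K = -2`, `a = 3`, then `n₁ ≡ 1`, `u₁ = 2`
          have hK' : D / 8 % 4 = 3 := by omega
          have hn : d₁ / 8 % 4 = 1 := by omega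
          exact ⟨3, 2, d₁ / 8, Or.inl rfl, by omega, hn,
            Or.inl ⟨rfl, Or.inr rfl⟩,
            Or.inr ⟨-2, -(D / 8), by omega, by omega, Or.inl ⟨rfl, rfl⟩⟩⟩
    · rcases TD with ⟨vD, rD⟩ | ⟨vD, eD, rD⟩ | ⟨vD, eD, rD⟩
      · -- `(3,3,0)`: `a = 5`
        by_cases hn : d₁ / 8 % 4 = 1
        · exact ⟨5, 2, d₁ / 8, Or.inr (Or.inl rfl), by omega, hn,
            Or.inr (Or.inl ⟨rfl, Or.inl rfl⟩), Or.inl rD⟩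
        · exact ⟨5, -2, -(d₁ / 8), Or.inr (Or.inl rfl), by omega, by omega,
            Or.inr (Or.inl ⟨rfl, Or.inr rfl⟩), Or.inl rD⟩
      · -- `(3,3,2)`: `a = 5`, `u_K = -1`
        by_cases hn : d₁ / 8 % 4 = 1
        · exact ⟨5, 2, d₁ / 8, Or.inr (Or.inl rfl), by omega, hn,
            Or.inr (Or.inl ⟨rfl, Or.inl rfl⟩),
            Or.inr ⟨-1, -(D / 4), by omega, by omega, Or.inr (Or.inl ⟨rfl, rfl⟩)⟩⟩
        · exact ⟨5, -2, -(d₁ / 8), Or.inr (Or.inl rfl), by omega, by omega,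
            Or.inr (Or.inl ⟨rfl, Or.inr rfl⟩),
            Or.inr ⟨-1, -(D / 4), by omega, by omega, Or.inr (Or.inl ⟨rfl, rfl⟩)⟩⟩
      · omega

end Dyadic

/-! ## §6 The dyadic vanishing and the passage `d₁ ↔ d₂` -/

section DyadicMain

variable {K : Type} [Field K] [NumberField K]

/-- **At `2 ∣ c`, the rational character for `d₁` is ramified above `2` and `heckeValueAt χ_gal w = 0`**
for every place `w ∣ 2` of the quadratic field `K`, when `d₁ d₂ = d_K c²` with `d₁, d₂`
fundamental discriminants. By `dyadic_configuration` there is an odd residue `a (mod 8)` whose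
inertia element `τ ∈ I_2 ≤ Γ_ℚ` with `χ₈(τ) = a` (`exists_mem_inertia_modEight_val_eq`) fixes
`√d_K` and negates `√d₁` (the `2`-primary parts `u_K ≠ u₁` of `d_K`, `d₁` are distinguished by a
quadratic character of conductor dividing `8`; the odd parts `n ≡ 1 (mod 4)` have square roots fixed
by inertia at `2`); then `heckeValueAt_eq_zero_of_inertia_rat` applies. This is the vanishing
"`χ(𝔞) = 0` for `𝔞` not prime to `c`" of the genus character at the even part of the conductor.
[cite: Gross2004, §3 p. 40] [cite: Cox2013, Lemma 1.14 and Thm. 3.15 (genus characters)] -/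
theorem heckeValueAt_eq_zero_of_isRationalCharacterFor_of_two_dvd (h2 : Module.finrank ℚ K = 2)
    {χgal : absoluteGaloisGroup K →ₜ* ℂˣ} {d₁ d₂ : ℤ} {c : ℕ} (hχ : IsRationalCharacterFor χgal d₁)
    (hd₁ : (d₁ % 4 = 1 ∧ Squarefree d₁ ∧ d₁ ≠ 1) ∨
      (4 ∣ d₁ ∧ (d₁ / 4 % 4 = 2 ∨ d₁ / 4 % 4 = 3) ∧ Squarefree (d₁ / 4)))
    (hd₂ : (d₂ % 4 = 1 ∧ Squarefree d₂ ∧ d₂ ≠ 1) ∨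
      (4 ∣ d₂ ∧ (d₂ / 4 % 4 = 2 ∨ d₂ / 4 % 4 = 3) ∧ Squarefree (d₂ / 4)))
    (hD : d₁ * d₂ = NumberField.discr K * (c : ℤ) ^ 2) (hc0 : c ≠ 0) (h2c : 2 ∣ c)
    {w : HeightOneSpectrum (𝓞 K)} (hw : (2 : 𝓞 K) ∈ w.asIdeal) : heckeValueAt χgal w = 0 := by
  have hDf := Literature.NumberTheory.QuadraticFields.Quadratic.isFundamentalDiscriminant_discr
    (K := K) h2
  have hd0 : d₁ ≠ 0 := by rcases hd₁ with ⟨h, _⟩ | ⟨_, h, _⟩ <;> omega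
  obtain ⟨a, u₁, n₁, ha, hd₁eq, hn₁, hu₁, hK⟩ := dyadic_configuration hd₁ hd₂ hDf hD hc0 h2c
  obtain ⟨s₁, s₂, s₃, hs₁, hs₂, hs₃, hact⟩ := exists_sqrt_negOne_two_negTwo
  refine heckeValueAt_eq_zero_of_inertia_rat h2 hd0 hχ fun 𝔓₀ h𝔓₀ => ?_
  have hv₀ : (2 : 𝓞 ℚ) ∈ (w.under (𝓞 ℚ)).asIdeal := by
    change (2 : 𝓞 ℚ) ∈ w.asIdeal.under (𝓞 ℚ)
    rw [Ideal.under_def, Ideal.mem_comap, map_ofNat]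
    exact hw
  obtain ⟨τ, hτI, hτa⟩ := exists_mem_inertia_modEight_val_eq hv₀ h𝔓₀ (a := a)
    (by rcases ha with rfl | rfl | rfl <;> decide) (by omega)
  obtain ⟨h3, h5, h7⟩ := hact τ
  rw [hτa] at h3 h5 h7
  -- casts of the three square roots
  have hs₁' : s₁ ^ 2 = ((-1 : ℤ) : AlgebraicClosure ℚ) := by rw [hs₁]; push_cast; ring
  have hs₂' : s₂ ^ 2 = ((2 : ℤ) : AlgebraicClosure ℚ) := by rw [hs₂]; push_cast; ring
  have hs₃' : s₃ ^ 2 = ((-2 : ℤ) : AlgebraicClosure ℚ) := by rw [hs₃]; push_cast; ring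
  -- a square root of `u₁` NEGATED by `τ`
  have hneg : ∃ s : AlgebraicClosure ℚ, s ^ 2 = (u₁ : AlgebraicClosure ℚ) ∧
      τ • s = ((-1 : ℤ) : AlgebraicClosure ℚ) * s := by
    have e : ∀ s : AlgebraicClosure ℚ, -s = ((-1 : ℤ) : AlgebraicClosure ℚ) * s := fun s => by
      push_cast; ring
    rcases hu₁ with ⟨ha3, hu⟩ | ⟨ha5, hu⟩ | ⟨ha7, hu⟩
    · obtain ⟨h₁, h₂, -⟩ := h3 ha3
      rcases hu with rfl | rfl
      · exact ⟨s₁, hs₁', by rw [h₁, e]⟩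
      · exact ⟨s₂, hs₂', by rw [h₂, e]⟩
    · obtain ⟨-, h₂, h₃⟩ := h5 ha5
      rcases hu with rfl | rfl
      · exact ⟨s₂, hs₂', by rw [h₂, e]⟩
      · exact ⟨s₃, hs₃', by rw [h₃, e]⟩
    · obtain ⟨h₁, -, h₃⟩ := h7 ha7
      rcases hu with rfl | rfl
      · exact ⟨s₁, hs₁', by rw [h₁, e]⟩
      · exact ⟨s₃, hs₃', by rw [h₃, e]⟩
  -- `τ` fixes `√d_K`
  have hfixD : τ • WeierstrassCurve.geomSqrt ((NumberField.discr K : ℚ)) =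
      WeierstrassCurve.geomSqrt ((NumberField.discr K : ℚ)) := by
    have hsq : WeierstrassCurve.geomSqrt ((NumberField.discr K : ℚ)) ^ 2 =
        (NumberField.discr K : AlgebraicClosure ℚ) := by
      rw [WeierstrassCurve.geomSqrt_sq, map_intCast]
    rcases hK with hK1 | ⟨u, n, hDeq, hn, hu⟩
    · exact smul_eq_of_emod_four_eq_one hv₀ h𝔓₀ hτI hK1 hsq
    · -- a square root of `u` FIXED by `τ`
      have hfix : ∃ s : AlgebraicClosure ℚ, s ^ 2 = (u : AlgebraicClosure ℚ) ∧
          τ • s = ((1 : ℤ) : AlgebraicClosure ℚ) * s := by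
        have e : ∀ s : AlgebraicClosure ℚ, s = ((1 : ℤ) : AlgebraicClosure ℚ) * s := fun s => by
          push_cast; ring
        rcases hu with ⟨ha3, rfl⟩ | ⟨ha5, rfl⟩ | ⟨ha7, rfl⟩
        · obtain ⟨-, -, h₃⟩ := h3 ha3
          exact ⟨s₃, hs₃', by rw [h₃]; exact e _⟩
        · obtain ⟨h₁, -, -⟩ := h5 ha5
          exact ⟨s₁, hs₁', by rw [h₁]; exact e _⟩
        · obtain ⟨-, h₂, -⟩ := h7 ha7
          exact ⟨s₂, hs₂', by rw [h₂]; exact e _⟩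
      obtain ⟨s, hs, hτs⟩ := hfix
      set t := WeierstrassCurve.geomSqrt ((n : ℚ)) with htdef
      have ht : t ^ 2 = (n : AlgebraicClosure ℚ) := by
        rw [htdef, WeierstrassCurve.geomSqrt_sq, map_intCast]
      have hτt : τ • t = t := smul_eq_of_emod_four_eq_one hv₀ h𝔓₀ hτI hn ht
      have := smul_eq_of_sq_eq_four_mul hs ht hDeq hsq hτs hτt
      rwa [Int.cast_one, one_mul] at this
  -- `τ` negates `√d₁ = 2 √u₁ √n₁`
  obtain ⟨s, hs, hτs⟩ := hneg
  set t := WeierstrassCurve.geomSqrt ((n₁ : ℚ)) with htdef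
  have ht : t ^ 2 = (n₁ : AlgebraicClosure ℚ) := by
    rw [htdef, WeierstrassCurve.geomSqrt_sq, map_intCast]
  have hτt : τ • t = t := smul_eq_of_emod_four_eq_one hv₀ h𝔓₀ hτI hn₁ ht
  have hy : (2 * s * t) ^ 2 = (d₁ : AlgebraicClosure ℚ) := by
    rw [hd₁eq]; push_cast; rw [← hs, ← ht]; ring
  refine ⟨τ, hτI, hfixD, 2 * s * t, hy, ?_⟩
  have := smul_eq_of_sq_eq_four_mul hs ht hd₁eq hy hτs hτt
  rw [this]; push_cast; ring

omit [NumberField K] in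
/-- **`IsRationalCharacterFor` passes from `d₁` to `d₂` when `d₁ d₂ = d_K c²`**: with `θ ∈ K`,
`θ² = d_K`, the element `r₂ = θ c r₁ / d₁ ∈ K̄` satisfies `r₂² = d_K c² / d₁ = d₂` and is moved by
every `γ ∈ Γ_K` exactly as `r₁` is (Gross: "`χ` corresponds to the unordered pair `{d₁, d₂}`";
on ideals prime to `D`, `χ_{d₁} ∘ N = χ_{d₂} ∘ N`). [cite: Gross2004, §3 p. 40] -/
theorem isRationalCharacterFor_of_mul_eq_discr [NumberField K] (h2 : Module.finrank ℚ K = 2)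
    {χgal : absoluteGaloisGroup K →ₜ* ℂˣ} {d₁ d₂ : ℤ} {c : ℕ} (hd₁0 : d₁ ≠ 0) (hc0 : c ≠ 0)
    (hχ : IsRationalCharacterFor χgal d₁) (hD : d₁ * d₂ = NumberField.discr K * (c : ℤ) ^ 2) :
    IsRationalCharacterFor χgal d₂ := by
  obtain ⟨θ, -, hθ⟩ := exists_sq_eq_discr_not_mem_range K h2
  obtain ⟨r₁, hr₁, hχr⟩ := hχ
  haveI : CharZero (AlgebraicClosure K) :=
    charZero_of_injective_algebraMap (algebraMap K (AlgebraicClosure K)).injective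
  have hd₁0' : (d₁ : AlgebraicClosure K) ≠ 0 := by exact_mod_cast hd₁0
  have hd₂0 : d₂ ≠ 0 := by
    intro h
    rw [h, mul_zero] at hD
    have hDK : NumberField.discr K ≠ 0 := NumberField.discr_ne_zero K
    have : (c : ℤ) ^ 2 ≠ 0 := pow_ne_zero _ (by exact_mod_cast hc0)
    exact mul_ne_zero hDK this hD.symm
  have hθ' : (algebraMap K (AlgebraicClosure K) θ) ^ 2 =
      (NumberField.discr K : AlgebraicClosure K) := by
    rw [← map_pow, hθ, map_intCast, map_intCast]
  have hDcast : (d₁ : AlgebraicClosure K) * d₂ =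
      (NumberField.discr K : AlgebraicClosure K) * (c : AlgebraicClosure K) ^ 2 := by
    exact_mod_cast hD
  have hu : (d₁ : AlgebraicClosure K) * (d₁ : AlgebraicClosure K)⁻¹ = 1 := mul_inv_cancel₀ hd₁0'
  set r₂ : AlgebraicClosure K := algebraMap K _ θ * (c : AlgebraicClosure K) * r₁ *
    (d₁ : AlgebraicClosure K)⁻¹ with hr₂
  have hr₂sq : r₂ ^ 2 = (d₂ : AlgebraicClosure K) := by
    calc r₂ ^ 2 = (algebraMap K _ θ) ^ 2 * (c : AlgebraicClosure K) ^ 2 * r₁ ^ 2 *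
          ((d₁ : AlgebraicClosure K)⁻¹) ^ 2 := by rw [hr₂]; ring
      _ = (d₂ : AlgebraicClosure K) := by
        rw [hθ', hr₁]
        linear_combination ((NumberField.discr K : AlgebraicClosure K) * (c : AlgebraicClosure K) ^ 2 *
            (d₁ : AlgebraicClosure K)⁻¹ + d₂) * hu - (d₁ : AlgebraicClosure K)⁻¹ * hDcast
  refine ⟨r₂, hr₂sq, fun γ => ?_⟩
  have hγ : γ • r₂ = algebraMap K _ θ * (c : AlgebraicClosure K) * (γ • r₁) *
      (d₁ : AlgebraicClosure K)⁻¹ := by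
    rw [hr₂]
    simp only [absoluteGaloisGroup.smul_def, map_mul, map_inv₀, map_natCast, map_intCast,
      AlgEquiv.commutes]
  rw [hχr γ]
  rcases smul_sqrt_eq_or_eq_neg γ hr₁ with h | h
  · rw [if_pos h, if_pos (by rw [hγ, h])]
  · have hne₂ : γ • r₂ ≠ r₂ := by
      rw [hγ, h, show algebraMap K _ θ * (c : AlgebraicClosure K) * -r₁ *
          (d₁ : AlgebraicClosure K)⁻¹ = -r₂ by rw [hr₂]; ring]
      exact sqrt_ne_neg_self hd₂0 hr₂sq
    rw [if_neg (by rw [h]; exact sqrt_ne_neg_self hd₁0 hr₁), if_neg hne₂]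

end DyadicMain

end Literature.NumberTheory.EllipticCurves.Gross2004

end
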